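import Summits.Parity.BatemanHorn.Theses.IsogenyRedei
import Literature.NumberTheory.LFunctions.RHWave0PNTProofs
import Literature.NumberTheory.LFunctions.MoebiusLogHarmonicSum
import Literature.NumberTheory.LFunctions.MertensConstant

/-!
# Disproof workfile for crux `PolyMobiusTail` (stmt-Parity-0870) — standing adversary (cdisprove)

Crux (verbatim in routes PolynomialMobius / CyclotomicTower / IsogenyRedei / CrossedSalie / GaussianFractions):
for every Bateman–Horn system `f = (f₁,…,f_k)` there is `η ∈ (0,1)` with
`Tail_η(x) := ∑_{n ≤ x} ∑_{dᵢ ∣ fᵢ(n), x^{1-η} < ∏ dᵢ} ∏ᵢ μ(dᵢ) log dᵢ = o(x)`.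

## LANDED (gate-accepted, kernel-checked, std axioms) — import these, they carry the proofs:
* `Summits.Parity.BatemanHorn.Theorems.PolyMobiusTail.Negative.CancellationAcrossN` (p84376 @e4adcf2dc632):
  `polyMobiusTail_tight_at_eta_one`, `polyMobiusTail_allEtaClosed_false`, `polyMobiusTail_abs_false`,
  `polyMobiusTail_primeDivisors_false`, `tail_X_one_eq_neg_psi`, `not_isLittleO_neg_psi`, …
* `…Negative.Structure` (p84671 @d93ce2ffa141): `polyMobiusTail_iff_withoutLeadingCoeffPos`,
  `polyMobiusTail_withoutEtaPos_trivial`, `tail_eventually_eq_zero_of_eta_neg`, `polyMobiusTail_fin_zero`, …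
* `…Negative.Equivalence` (p84703 @397d3a2fd9d2): `sum_prod_vonMangoldt_eq_typeI_add_tail`,
  `polyMobiusTail_iff_lambdaBatemanHorn`, `polyMobiusTail_iff_forall_eta`, `tail_isLittleO_of_isEquivalent`,
  `typeI_one_eq_zero`, `tail_one_eq_neg_one_pow_mul_sum_prod_vonMangoldt`,
  `sum_prod_vonMangoldt_lower_of_tail_lower`, `infinite_primePow_tuples_of_linear_lower`, `tail_fin_one_eq_counted`.
* `…Negative.LinearSlice` (p84512 @2fc883e84dc1): `tail_X_eq`, `abs_roundingError_le`, `tail_X_isLittleO`.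
This self-contained workfile PRE-DATES the landings (same theorems under `…Cruxes.PolyMobiusTail.Disproof.*`,
proved here verbatim); a slim version importing the landed modules replaces it once the farm has built them.
What cannot land stays here: the `Without*` variants, the `(X,X)` NEAR-MISS (the one `sorry`), the numerics.

## Findings (index; every `theorem` below is sorry-free unless its docstring says NEAR-MISS)

* **Elaboration / reading.** rc 0 by import; `tailSum` below is the crux function verbatim
  (`polyMobiusTail_iff` is `Iff.rfl`). Coercions: `(x:ℝ)^(1-η)` is `Real.rpow`; `((fᵢ).eval n).toNat`
  sends non-positive values to `0`, `Nat.divisors 0 = ∅`, so such `n` contribute `0` (finitely many `n`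
  for a BH system, and for fixed `n` the bracket is eventually false anyway) — no junk.
* **§0b** `tail_fin_one_eq_counted`: `Tail_η(g;x) = -∑_{n≤x}Λ(g(n)) - ∑_{d≤x^{1-η}} μ(d) log d·#{n≤x : d ∣ g(n) ≥ 1}`.
* **§1 WHY IT RESISTS — the crux is Bateman–Horn.** `polyMobiusTail_iff_lambdaBatemanHorn`:
  assuming the theorem-grade support `TypeIMainTerm` (stmt-Parity-0873),
  `PolyMobiusTail ↔ LambdaBatemanHorn` (`∑_{n≤x} ∏ Λ(fᵢ(n)) ∼ C(f)·x` for EVERY BH system), via the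
  exact identity `lambdaSum_eq_typeI_add_tail` (no hypothesis on `f`). Hence a disproof of the crux is
  exactly a disproof of (Λ-form) Bateman–Horn for one explicit system: none is known or expected over `ℤ`
  (the function-field bias `Literature.Barriers.Parity.FunctionFieldMobiusBias` needs INSEPARABLE `f`,
  which does not exist over `ℤ`; Bombieri's indeterminacy
  `Literature.NumberTheory.Sieve.bombieri_asymptotic_sieve_indeterminacy` and
  `Literature.Barriers.Parity.FordFixedLevelBarrier` say Type-I data of level `< 1` cannot DECIDE it
  either way — a barrier to proofs, not a counterexample).
* **§1b** `polyMobiusTail_iff_forall_eta` (hMain): `∃ η ∈ (0,1)` ⇔ `∀ η ∈ (0,1)` — the truth value is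
  `η`-independent inside the open interval; the only boundary phenomenon is `η = 1` (§4).
* **§1c** `sum_prod_vonMangoldt_lower_of_tail_lower` + `infinite_primePow_tuples_of_linear_lower`: an eventual
  ONE-SIDED bound `(-1)^k Tail_η ≥ -(1-δ)C(f)x` already gives `∑∏Λ ≥ (δ/2)C x`, hence infinitely many
  prime-power tuples — the lower half of the crux is the qualitative conjecture, the upper half the asymptotic
  upper bound; Bombieri's factor-2 indeterminacy spans exactly this gap.
* **§2 Degenerate slices closed.** `k = 0`: the empty system IS a BH system and its tail is identically
  `0` for `x ≥ 1` (`polyMobiusTail_fin_zero`) — not a counterexample. `k = 1, f = X`: the tail is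
  `-ψ(x) - ∑_{d ≤ x^{1-η}} μ(d) log d ⌊x/d⌋`, `o(x)` by the prime number theorem with the classical
  `∑ μ(d) log d / d = -1` (not in Mathlib; numerics column A).
* **§3 LOAD-BEARING ANALYSIS of the four `IsBatemanHornSystem` fields** (drop one at a time):
  - `pairwise_not_associated`: LOAD-BEARING. Witness `(X, X)`: `Tail_η(x) ≈ ((3+η)/4)·x·log x` (full sum is
    `∑ Λ(n)² ∼ x log x`, Type-I piece only `≈ ((1-η)/4) x log x`; numerics D: `Tail/(x log x) = 0.67…0.93` at
    `x = 10⁶`, matching `(3+η)/4 - 1/log x` to ±0.05).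
    NEAR-MISS `polyMobiusTail_false_without_nonAssoc` (sorry: needs `∑_{n≤x} Λ(n)² ≫ x log x` minus a
    matching UPPER bound for the hyperbolically truncated Type-I piece — PNT-strength 2-variable Möbius
    cancellation, not available).
  - `hasNoFixedPrimeDivisor`: NOT load-bearing for the truth of the tail statement (it is load-bearing
    for `C(f) > 0` in `TypeIMainTerm`). With a fixed prime divisor the Λ-sum is `O(polylog x)` (only
    prime-power values survive, e.g. `X²+X+2 = 2^a` ⇔ Ramanujan–Nagell, 5 solutions) and the truncated
    log-weighted singular series tends to `0` (double zero of `∏_p (1 - ρ(p)p^{-s})` at `s = 1`), so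
    Type-I and tail are both `o(x)` (numerics E `(X, X+1)`, F `X²+X+2`). No counterexample expected.
  - `irreducible`: NOT load-bearing for truth: `f = g·h` behaves like a system with `C = 0`
    (numerics G `X²+2X`), `f = g^m` reduces to `g` (squarefree divisors of `g(n)^m` = those of `g(n)`).
  - `leadingCoeff_pos`: NOT load-bearing for truth (negative leading coefficient ⇒ `toNat = 0`
    eventually in `n`, tail eventually `0`): it is a non-vacuity guard only.
  - the conclusion's `0 < η`: non-triviality guard — with `η ≤ -∑ deg fᵢ` the bracket
    `x^{1-η} < ∏ dᵢ` is eventually never satisfied (`∏ dᵢ ≤ ∏ fᵢ(n) ≪ x^{∑ deg fᵢ}`), tail eventually `0`.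
* **§4 TIGHTNESS.** `tailSum_X_one_not_isLittleO`: at the closed endpoint `η = 1` the tail of `(X)` is
  `-ψ(x)` (`tailSum₁_X_one`), not `o(x)` by Chebyshev (`Chebyshev.psi_ge`). The open range cannot be
  closed; conjecturally EVERY `η ∈ (0,1)` works (given Λ-BH, by §1's subtraction for each `η`).
For general `k ≥ 1`: `tailSum_one_eq` — `tailSum f 1 x = (-1)^k lambdaSum f x` (Type-I empty at `η = 1`,
  `typeI_one_eq_zero`), so the closed endpoint would negate Bateman–Horn for every BH system.
* **§5 NATURAL STRENGTHENINGS REFUTED.** (1) `not_polyMobiusTailAllEtaClosed` (`∀ η ∈ (0,1]`).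
  (2) `not_polyMobiusTailAbs`: with `|·|` around each inner divisor sum the statement fails for `(X)` at
  EVERY `η > 0` (`tailSumAbs_X_not_isLittleO`: primes `p ∈ (x^{1-η}, x]` each give `log p` with the same
  sign, total `≥ θ(x) - θ(x^{1-η}) ≫ x`). (3) `polyMobiusTail_primeDivisors_false`: with `primeFactors` in place of `divisors` (prime `d` only) the
  statement fails for `(X)` at every `η ∈ (0,1)` (prime-divisor tail `= -∑_{y<p≤x} log p ⌊x/p⌋ ≈ -η x log x`,
  Mertens I from the tree). MESSAGE TO PROVERS: the `o(x)` is cancellation BETWEEN prime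
  `n` (mass `≈ -x·(stuff)`) and composite `n`; no argument bounding each `n`'s inner sum can work, and for
  `deg ≥ 2` the analogue says the sign pattern of `μ` on the large cofactors must be equidistributed along
  the root classes — the parity content.
* **§8 POSITIVE ANCHOR.** `tail_X_isLittleO`: for `f = (X)` the crux holds at EVERY `η ∈ (0,1)` (closed form
  `tail_X_eq` = `-ψ(x) - x∑_{d≤x^{1-η}} μ(d)log d/d + O(x^{1-η} log x)`, PNT `chebyshevPsi_isEquivalent_holds`
  and Landau `tendsto_sum_moebius_mul_log_div`, both PROVED in the tree) — the formalisation is faithful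
  on the one slice that is a theorem, and the `η`-range there is exactly the open interval (cf. §4).
* **§6 Targets.** none yet (payload.targets = []); re-arm will add the lead's stuck stubs here.
* **§7 Numerics** (kit job j012719, `x ≤ 10⁶`, 112 s; script job1/main.py; table `outputs/table.txt` attached to
  the item as compute evidence; local cross-check numerics_local_1e5.txt): systems A `X`, B `X²+1`,
  C `(X,X+2)`, D `(X,X)`, E `(X,X+1)`, F `X²+X+2`, G `X²+2X`; `η ∈ {0.05,0.1,0.2,0.3,0.5,0.7,0.9}` (values
  below in that order); exact identity `Full = (-1)^k ∑∏Λ` checked to 1e-6 at `x = 2000` for every system.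
  At `x = 10⁶`:
  A: `Full/x = -0.9996`; `Tail/x = +0.004, +0.002, +0.006, +0.016, -0.030, -0.066, -0.287`.
  B: `Full/x = -1.3763` (`C(X²+1) = 1.3728`); `Tail/x = -0.005, +0.012, +0.002, +0.006, -0.001, +0.177, -1.03`.
  C: `Full/x = +1.3128` (`2C₂ = 1.3203`); `Tail/x = -0.048, -0.082, -0.037, -0.362, -0.691, +0.163, +1.313`
     (at `x = 10⁵`: `-0.66, -0.63, -0.34, -0.73, +0.26, +1.16, +1.32`) — for `k = 2` the Type-I piece
     approaches its limit only slowly in `y = x^{1-η}` (2-variable hyperbolic truncation; boundary terms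
     `≍ y (log y)^3`), so the `k ≥ 2` tail is numerically accessible only for `η ≲ 0.2` at `x = 10⁶`.
  D: `Full/x = 12.80 ≈ log x - 1`; `Tail/(x log x) = 0.67, 0.75, 0.72, 0.80, 0.83, 0.85, 0.93` — growth
     `∝ x log x` confirmed (`0.64…0.89` at `10⁴`, `0.68…0.91` at `10⁵`).
  E: `Tail/x = +0.12, +0.20, +0.48, +0.58, -0.53, -1.84, +0.00005`; F: `-0.012, +0.025, +0.062, +0.097,
     +0.364, +0.880, +0.693`; G: `+0.018, +0.009, +0.023, -0.007, -0.494, +0.230, +1.079` — the `C = 0`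
     systems drift to `0` where `y` is large (compare F at `10⁴`: `0.12, 0.26, 0.30, 0.49, …`), no sign of a
     counterexample when `hasNoFixedPrimeDivisor` / `irreducible` are dropped.
* **§8 POSITIVE ANCHOR.** `tail_X_isLittleO`: for `f = (X)` the crux holds at EVERY `η ∈ (0,1)` (closed form
  `tail_X_eq` = `-ψ(x) - x∑_{d≤x^{1-η}} μ(d)log d/d + O(x^{1-η} log x)`, PNT `chebyshevPsi_isEquivalent_holds`
  and Landau `tendsto_sum_moebius_mul_log_div`, both PROVED in the tree) — the formalisation is faithful
  on the one slice that is a theorem, and the `η`-range there is exactly the open interval (cf. §4).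
* **§6 Targets.** none yet (payload.targets = []); re-arm will add the lead's stuck stubs here.
* **§7 Numerics** (script job1/main.py; local table numerics_local_1e5.txt for `x ≤ 10⁵`, kit job j012719
  queued for `x ≤ 10⁶`, attached to the item as evidence when it runs): systems A `X`, B `X²+1`,
  C `(X,X+2)`, D `(X,X)`, E `(X,X+1)`, F `X²+X+2`, G `X²+2X`; `η ∈ {0.05,0.1,0.2,0.3,0.5,0.7,0.9}`;
  exact identity `Full = (-1)^k ∑∏Λ` checked to 1e-6 at `x = 2000` for every system. At `x = 10⁵`:
  A: `Full/x = -1.0005`, `Tail/x = -0.005, -0.021, +0.018, -0.034, +0.021, +0.217, -0.288` (η ↑);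
  B: `Full/x = -1.382` (`C(X²+1) = 1.3728`), `Tail/x = -0.003, +0.003, +0.033, +0.068, -0.011, -0.143, -1.04`;
  C: `Full/x = +1.315` (`2C₂ = 1.3203`) but `Tail/x = -0.66, -0.63, -0.34, -0.73, +0.26, +1.16, +1.32` —
  for `k = 2` the Type-I piece is nowhere near its limit at `y = x^{1-η} ≤ 10^{4.5}` (boundary terms
  `≍ y (log y)^3 ≳ x` for `η ≤ 0.3`, and slow 2-variable convergence beyond), so moderate-`x` numerics
  cannot probe the `k ≥ 2` tail at all; D: `Full/x = 10.50 ≈ log x - 1`, `Tail/(x log x) = 0.68…0.91`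
  for all `η` (growth confirmed: 0.64…0.89 at `x = 10⁴`); E/F/G (`C = 0` systems): `|Tail/x|` at
  `η ≤ 0.1` is `0.36/0.15` (E), `0.06/0.02` (F), `0.04/0.19` (G), decreasing from `x = 10⁴` where
  measurable — consistent with `o(x)`, no sign of a counterexample.

Nearest prior art / barriers consulted: BombieriAsymptoticSieve1976 (tree fact above), Ford2004
(`FordFixedLevelBarrier`), Conrad–Conrad–Gross 2008 (`FunctionFieldMobiusBias`, scope caveat: no integer
analogue), Friedlander–Granville 1992 (`FriedlanderGranvilleUniformityBarrier`: a UNIFORM-in-`f` version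
of the crux over the linear family `qX+a` would be false, but the crux fixes `f` first — not applicable).
`ledger negatives --problem Parity`: 3 entries, none about polynomial Möbius tails. Literature search this
session was DEGRADED (local FTS down, OpenAlex/S2 429; crossref only: SawinShusterman2022 Invent. Math.,
Baier2002 JNT "On the Bateman–Horn conjecture" (average results); `lit galaxy search "Bateman-Horn"`: only
general references — Shanks, Guy, Diamond–Halberstam); no integer counterexample or bias is reported anywhere.
-/

open scoped BigOperators
open Filter Asymptotics Polynomial ArithmeticFunction

namespace Summit.Parity.BatemanHorn.Cruxes.PolyMobiusTail.Disproof

open Summit.Parity.BatemanHorn.Theses.IsogenyRedei Literature.NumberTheory.Sieve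

/-- The tail sum of the crux as a function of the system `f`, the exponent `η` and `x`
(verbatim the function inside `PolyMobiusTail`). -/
noncomputable def tailSum {k : ℕ} (f : Fin k → ℤ[X]) (η : ℝ) (x : ℕ) : ℝ :=
  ∑ n ∈ Finset.Icc 1 x, ∑ d ∈ Fintype.piFinset (fun i => (((f i).eval (n : ℤ)).toNat).divisors),
    if (x : ℝ) ^ (1 - η) < ∏ i, (d i : ℝ) then ∏ i, ((moebius (d i) : ℝ) * Real.log (d i)) else 0

theorem polyMobiusTail_iff :
    PolyMobiusTail ↔ ∀ (k : ℕ) (f : Fin k → ℤ[X]), IsBatemanHornSystem f →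
      ∃ η : ℝ, 0 < η ∧ η < 1 ∧ (tailSum f η) =o[atTop] (fun x : ℕ => (x : ℝ)) := Iff.rfl

/-- The one-polynomial tail (the `k = 1` slice with the `Fin 1` bookkeeping removed). -/
noncomputable def tailSum₁ (g : ℤ[X]) (η : ℝ) (x : ℕ) : ℝ :=
  ∑ n ∈ Finset.Icc 1 x, ∑ d ∈ ((g.eval (n : ℤ)).toNat).divisors,
    if (x : ℝ) ^ (1 - η) < (d : ℝ) then (moebius d : ℝ) * Real.log d else 0

theorem sum_piFinset_fin_one (t : Fin 1 → Finset ℕ) (G : ℕ → ℝ) :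
    ∑ d ∈ Fintype.piFinset t, G (d 0) = ∑ j ∈ t 0, G j := by
  have h := Finset.prod_univ_sum t (fun _ j => G j)
  simp only [Fin.prod_univ_one] at h
  exact h.symm

theorem tailSum_fin_one (g : ℤ[X]) (η : ℝ) (x : ℕ) : tailSum ![g] η x = tailSum₁ g η x := by
  unfold tailSum tailSum₁
  refine Finset.sum_congr rfl fun n _ => ?_
  simp only [Fin.prod_univ_one, Matrix.cons_val_fin_one]
  exact sum_piFinset_fin_one (fun _ => ((g.eval (n : ℤ)).toNat).divisors)
    (fun j => if (x : ℝ) ^ (1 - η) < (j : ℝ) then (moebius j : ℝ) * Real.log j else 0)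

/-- At the endpoint `η = 1` the tail of the single polynomial `X` is `-ψ(x)`. -/
theorem tailSum₁_X_one (x : ℕ) : tailSum₁ X 1 x = -Chebyshev.psi x := by
  unfold tailSum₁
  have hx : ((x : ℝ)) ^ ((1 : ℝ) - 1) = 1 := by rw [sub_self, Real.rpow_zero]
  simp only [eval_X, Int.toNat_natCast, hx]
  have inner : ∀ n : ℕ, (∑ d ∈ n.divisors, if (1 : ℝ) < (d : ℝ) then (moebius d : ℝ) * Real.log d else 0)
      = -vonMangoldt n := by
    intro n
    rw [← sum_moebius_mul_log_eq]
    refine Finset.sum_congr rfl fun d hd => ?_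
    have hd1 : 1 ≤ d := Nat.pos_of_mem_divisors hd
    rcases hd1.eq_or_lt with h | h
    · subst h; simp
    · have : (1 : ℝ) < (d : ℝ) := by exact_mod_cast h
      simp [this, ArithmeticFunction.log_apply]
  simp only [inner, Finset.sum_neg_distrib, Chebyshev.psi, Nat.floor_natCast]
  congr 1


/-- Chebyshev's lower bound makes `-ψ` NOT `o(x)` along the naturals. -/
theorem not_isLittleO_neg_psi :
    ¬ (fun x : ℕ => -Chebyshev.psi x) =o[atTop] (fun x : ℕ => (x : ℝ)) := by
  intro h
  -- log (x+1) = o(x) along ℕ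
  have hlog : (fun x : ℕ => Real.log ((x : ℝ) + 1)) =o[atTop] (fun x : ℕ => (x : ℝ)) := by
    have h1 : (fun y : ℝ => Real.log (y + 1)) =o[atTop] (fun y : ℝ => y + 1) :=
      Real.isLittleO_log_id_atTop.comp_tendsto (tendsto_atTop_add_const_right _ 1 tendsto_id)
    have h2 : (fun y : ℝ => y + 1) =O[atTop] (fun y : ℝ => y) := by
      refine IsBigO.of_bound 2 ?_
      filter_upwards [eventually_ge_atTop (1 : ℝ)] with y hy
      rw [Real.norm_eq_abs, Real.norm_eq_abs, abs_of_nonneg (by linarith), abs_of_nonneg (by linarith)]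
      linarith
    exact (h1.trans_isBigO h2).comp_tendsto tendsto_natCast_atTop_atTop
  -- hence x = O(ψ x): from ψ x ≥ x log 2 - log (x+1)
  have hbig : (fun x : ℕ => (x : ℝ)) =O[atTop] (fun x : ℕ => -Chebyshev.psi x) := by
    refine IsBigO.of_bound (2 / Real.log 2) ?_
    have hl2 : 0 < Real.log 2 := Real.log_pos one_lt_two
    filter_upwards [hlog.def (half_pos hl2), eventually_ge_atTop 1] with x hx hx1
    rw [Real.norm_eq_abs, Real.norm_eq_abs, abs_of_nonneg (Real.log_nonneg (by simp)),
      abs_of_nonneg (Nat.cast_nonneg x)] at hx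
    have hψ := Chebyshev.psi_ge x
    rw [Real.norm_eq_abs, abs_of_nonneg (Nat.cast_nonneg x), norm_neg, Real.norm_eq_abs,
      abs_of_nonneg (Chebyshev.psi_nonneg _)]
    rw [div_mul_eq_mul_div, le_div_iff₀ hl2]
    nlinarith
  have := hbig.trans_isLittleO h
  exact isLittleO_irrefl (by
    refine Filter.Eventually.frequently ?_
    filter_upwards [eventually_ge_atTop 1] with x hx
    simp; omega) this


/-- The single polynomial `X` is a Bateman–Horn system (the prime number theorem case). -/
theorem isBatemanHornSystem_X : IsBatemanHornSystem ![(X : ℤ[X])] where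
  irreducible i := by simpa using Polynomial.irreducible_X
  leadingCoeff_pos i := by simp
  pairwise_not_associated := fun i j hij => absurd (Subsingleton.elim i j) hij
  hasNoFixedPrimeDivisor p hp := by
    unfold polyRootCountMod
    have h : ((Finset.range p).filter fun n : ℕ => (p : ℤ) ∣ ∏ i, ((![(X : ℤ[X])] i).eval (n : ℤ)))
        = {0} := by
      ext n
      simp only [Finset.mem_filter, Finset.mem_range, Fin.prod_univ_one, Matrix.cons_val_fin_one,
        eval_X, Int.natCast_dvd_natCast, Finset.mem_singleton]
      constructor
      · rintro ⟨hn, hdvd⟩; exact Nat.eq_zero_of_dvd_of_lt hdvd hn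
      · rintro rfl; exact ⟨hp.pos, dvd_zero _⟩
    rw [h, Finset.card_singleton]; exact hp.one_lt

/-- TIGHTNESS at `η = 1`: for the BH system `(X)` the tail at the closed endpoint `η = 1` is `-ψ(x)`,
which is not `o(x)` (Chebyshev). So the open range `η < 1` in the crux cannot be closed. -/
theorem tailSum_X_one_not_isLittleO :
    ¬ (tailSum ![(X : ℤ[X])] 1) =o[atTop] (fun x : ℕ => (x : ℝ)) := by
  have h : tailSum ![(X : ℤ[X])] 1 = fun x : ℕ => -Chebyshev.psi x := by
    funext x; rw [tailSum_fin_one, tailSum₁_X_one]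
  rw [h]; exact not_isLittleO_neg_psi

/-- NATURAL STRENGTHENING 1 (refuted): `∀ η ∈ (0, 1]` in place of `∃ η ∈ (0, 1)`. -/
def PolyMobiusTailAllEtaClosed : Prop :=
  ∀ (k : ℕ) (f : Fin k → ℤ[X]), IsBatemanHornSystem f → ∀ η : ℝ, 0 < η → η ≤ 1 →
    (tailSum f η) =o[atTop] (fun x : ℕ => (x : ℝ))

theorem not_polyMobiusTailAllEtaClosed : ¬ PolyMobiusTailAllEtaClosed := fun h =>
  tailSum_X_one_not_isLittleO (h 1 ![X] isBatemanHornSystem_X 1 one_pos le_rfl)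


/-! ## Why it resists: modulo the theorem-grade Type-I main term the crux IS Bateman–Horn (Λ-form) -/

/-- The Type-I sum (complementary range `∏ dᵢ ≤ x^{1-η}`): verbatim the sum inside `TypeIMainTerm`
(without the sign `(-1)^k`). -/
noncomputable def typeISum {k : ℕ} (f : Fin k → ℤ[X]) (η : ℝ) (x : ℕ) : ℝ :=
  ∑ n ∈ Finset.Icc 1 x, ∑ d ∈ Fintype.piFinset (fun i => (((f i).eval (n : ℤ)).toNat).divisors),
    if ∏ i, (d i : ℝ) ≤ (x : ℝ) ^ (1 - η) then ∏ i, ((moebius (d i) : ℝ) * Real.log (d i)) else 0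

/-- The `Λ`-weighted prime-tuple sum `∑_{n ≤ x} ∏ᵢ Λ(fᵢ(n))` (verbatim the sum inside `LambdaToCount`). -/
noncomputable def lambdaSum {k : ℕ} (f : Fin k → ℤ[X]) (x : ℕ) : ℝ :=
  ∑ n ∈ Finset.Icc 1 x, ∏ i, vonMangoldt (((f i).eval (n : ℤ)).toNat)

theorem typeIMainTerm_iff :
    TypeIMainTerm ↔ ∀ (k : ℕ) (f : Fin k → ℤ[X]), IsBatemanHornSystem f → ∀ η : ℝ, 0 < η → η < 1 →
      ∃ C : ℝ, 0 < C ∧ HasBatemanHornConst f C ∧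
        (fun x : ℕ => (-1 : ℝ) ^ k * typeISum f η x) ~[atTop] (fun x : ℕ => C * (x : ℝ)) := Iff.rfl

/-- `Λ`-form of Bateman–Horn for every system: `∑_{n ≤ x} ∏ᵢ Λ(fᵢ(n)) ∼ C(f)·x`
(the hypothesis of the theorem-grade glue `LambdaToCount`). -/
def LambdaBatemanHorn : Prop :=
  ∀ (k : ℕ) (f : Fin k → ℤ[X]), IsBatemanHornSystem f →
    ∃ C : ℝ, 0 < C ∧ HasBatemanHornConst f C ∧ (lambdaSum f) ~[atTop] (fun x : ℕ => C * (x : ℝ))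

/-- The exact identity behind the split: `∑ ∏ Λ(fᵢ(n)) = (-1)^k · (TypeI + Tail)` for EVERY system,
every `η` and every `x` (no hypothesis on `f` is used: `Λ = -(μ·log) ∗ 1` coordinatewise,
`Finset.prod_univ_sum`, and the two cut-offs are complementary). -/
theorem lambdaSum_eq_typeI_add_tail {k : ℕ} (f : Fin k → ℤ[X]) (η : ℝ) (x : ℕ) :
    lambdaSum f x = (-1 : ℝ) ^ k * (typeISum f η x + tailSum f η x) := by
  have hΛ : ∀ m : ℕ, vonMangoldt m = -∑ e ∈ m.divisors, ((moebius e : ℝ) * Real.log e) := by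
    intro m
    have h := sum_moebius_mul_log_eq (n := m)
    simp only [ArithmeticFunction.log_apply] at h
    linarith
  have stepA : ∀ n : ℕ, (∏ i, vonMangoldt (((f i).eval (n : ℤ)).toNat))
      = (-1 : ℝ) ^ k * ∑ d ∈ Fintype.piFinset (fun i => (((f i).eval (n : ℤ)).toNat).divisors),
          ∏ i, ((moebius (d i) : ℝ) * Real.log (d i)) := by
    intro n
    simp_rw [hΛ]
    rw [Finset.prod_neg, Finset.card_univ, Fintype.card_fin, Finset.prod_univ_sum]
  have stepB : ∀ n : ℕ,
      (∑ d ∈ Fintype.piFinset (fun i => (((f i).eval (n : ℤ)).toNat).divisors),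
          ∏ i, ((moebius (d i) : ℝ) * Real.log (d i)))
      = (∑ d ∈ Fintype.piFinset (fun i => (((f i).eval (n : ℤ)).toNat).divisors),
          if ∏ i, (d i : ℝ) ≤ (x : ℝ) ^ (1 - η) then ∏ i, ((moebius (d i) : ℝ) * Real.log (d i)) else 0)
        + (∑ d ∈ Fintype.piFinset (fun i => (((f i).eval (n : ℤ)).toNat).divisors),
          if (x : ℝ) ^ (1 - η) < ∏ i, (d i : ℝ) then ∏ i, ((moebius (d i) : ℝ) * Real.log (d i)) else 0) := by
    intro n
    rw [← Finset.sum_add_distrib]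
    refine Finset.sum_congr rfl fun d _ => ?_
    by_cases h : ∏ i, (d i : ℝ) ≤ (x : ℝ) ^ (1 - η)
    · rw [if_pos h, if_neg (not_lt.mpr h), add_zero]
    · rw [if_neg h, if_pos (not_le.mp h), zero_add]
  unfold lambdaSum typeISum tailSum
  rw [← Finset.sum_add_distrib, Finset.mul_sum]
  refine Finset.sum_congr rfl fun n _ => ?_
  rw [stepA n, stepB n]

/-- **The crux is `Λ`-Bateman–Horn modulo the Type-I main term.** Given the theorem-grade support item
`TypeIMainTerm` (stmt-Parity-0873), `PolyMobiusTail` is EQUIVALENT to the `Λ`-form of Bateman–Horn for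
every system. (`→` is the route's `closes` minus `LambdaToCount`; `←` takes `η = 1/2`, identifies the
two constants by uniqueness of the ordered Euler-product limit, and subtracts.) Consequently every
disproof of the crux is a disproof of Bateman–Horn for some specific system, and conversely. -/
theorem polyMobiusTail_iff_lambdaBatemanHorn (hMain : TypeIMainTerm) :
    PolyMobiusTail ↔ LambdaBatemanHorn := by
  constructor
  · intro hTail k f hf
    obtain ⟨η, hη0, hη1, hT⟩ := hTail k f hf
    obtain ⟨C, hC, hHas, hM⟩ := hMain k f hf η hη0 hη1
    refine ⟨C, hC, hHas, ?_⟩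
    have hB := (hT.const_mul_left ((-1 : ℝ) ^ k)).trans_isBigO
      (isBigO_self_const_mul hC.ne' (fun x : ℕ => (x : ℝ)) atTop)
    refine (hM.add_isLittleO hB).congr_left (Eventually.of_forall fun x => ?_)
    simp only [Pi.add_apply]
    rw [lambdaSum_eq_typeI_add_tail f η x, mul_add]
    rfl
  · intro hΛ k f hf
    refine ⟨1 / 2, by norm_num, by norm_num, ?_⟩
    change (tailSum f (1 / 2)) =o[atTop] (fun x : ℕ => (x : ℝ))
    obtain ⟨C₁, hC₁, hHas₁, hL⟩ := hΛ k f hf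
    obtain ⟨C₂, -, hHas₂, hM⟩ := hMain k f hf (1 / 2) (by norm_num) (by norm_num)
    have hCC : C₁ = C₂ := tendsto_nhds_unique hHas₁ hHas₂
    subst hCC
    have hA : ((lambdaSum f) - fun x : ℕ => C₁ * (x : ℝ)) =o[atTop] (fun x : ℕ => (x : ℝ)) :=
      hL.isLittleO.trans_isBigO (isBigO_const_mul_self C₁ _ _)
    have hB : ((fun x : ℕ => (-1 : ℝ) ^ k * typeISum f (1 / 2) x) - fun x : ℕ => C₁ * (x : ℝ))
        =o[atTop] (fun x : ℕ => (x : ℝ)) :=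
      hM.isLittleO.trans_isBigO (isBigO_const_mul_self C₁ _ _)
    have hC := (hA.sub hB).const_mul_left ((-1 : ℝ) ^ k)
    refine hC.congr_left fun x => ?_
    simp only [Pi.sub_apply]
    rw [lambdaSum_eq_typeI_add_tail f (1 / 2) x]
    have h1 : ((-1 : ℝ) ^ k) ^ 2 = 1 := by rw [← pow_mul, mul_comm, pow_mul, neg_one_sq, one_pow]
    linear_combination (tailSum f (1 / 2) x) * h1


/-! ## Natural strengthening 2 (refuted): no cancellation ACROSS `n` -/

/-- The tail with absolute values around each inner divisor sum (i.e. forbidding cancellation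
between different `n`). -/
noncomputable def tailSumAbs {k : ℕ} (f : Fin k → ℤ[X]) (η : ℝ) (x : ℕ) : ℝ :=
  ∑ n ∈ Finset.Icc 1 x, |∑ d ∈ Fintype.piFinset (fun i => (((f i).eval (n : ℤ)).toNat).divisors),
    if (x : ℝ) ^ (1 - η) < ∏ i, (d i : ℝ) then ∏ i, ((moebius (d i) : ℝ) * Real.log (d i)) else 0|

/-- NATURAL STRENGTHENING 2: the crux with `|inner divisor sum|` (termwise in `n`). -/
def PolyMobiusTailAbs : Prop :=
  ∀ (k : ℕ) (f : Fin k → ℤ[X]), IsBatemanHornSystem f →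
    ∃ η : ℝ, 0 < η ∧ η < 1 ∧ (tailSumAbs f η) =o[atTop] (fun x : ℕ => (x : ℝ))

theorem tailSumAbs_fin_one (g : ℤ[X]) (η : ℝ) (x : ℕ) :
    tailSumAbs ![g] η x = ∑ n ∈ Finset.Icc 1 x, |∑ d ∈ ((g.eval (n : ℤ)).toNat).divisors,
      if (x : ℝ) ^ (1 - η) < (d : ℝ) then (moebius d : ℝ) * Real.log d else 0| := by
  unfold tailSumAbs
  refine Finset.sum_congr rfl fun n _ => ?_
  simp only [Fin.prod_univ_one, Matrix.cons_val_fin_one]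
  rw [sum_piFinset_fin_one (fun _ => ((g.eval (n : ℤ)).toNat).divisors)
    (fun j => if (x : ℝ) ^ (1 - η) < (j : ℝ) then (moebius j : ℝ) * Real.log j else 0)]

/-- Primes `p ≤ x` beyond the cut-off each contribute `|μ(p) log p| = log p` to the absolute tail of `(X)`. -/
theorem sum_log_le_tailSumAbs_X (η : ℝ) (x : ℕ) :
    ∑ p ∈ (Finset.Icc 1 x).filter (fun p : ℕ => p.Prime ∧ (x : ℝ) ^ (1 - η) < (p : ℝ)), Real.log p
      ≤ tailSumAbs ![(X : ℤ[X])] η x := by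
  rw [tailSumAbs_fin_one]
  simp only [eval_X, Int.toNat_natCast]
  calc ∑ p ∈ (Finset.Icc 1 x).filter (fun p : ℕ => p.Prime ∧ (x : ℝ) ^ (1 - η) < (p : ℝ)), Real.log p
      = ∑ p ∈ (Finset.Icc 1 x).filter (fun p : ℕ => p.Prime ∧ (x : ℝ) ^ (1 - η) < (p : ℝ)),
          |∑ d ∈ p.divisors, if (x : ℝ) ^ (1 - η) < (d : ℝ) then (moebius d : ℝ) * Real.log d else 0| := by
        refine Finset.sum_congr rfl fun p hp => ?_
        obtain ⟨-, hp, hyp⟩ := Finset.mem_filter.1 hp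
        rw [hp.divisors, Finset.sum_pair hp.one_lt.ne, if_pos hyp, ArithmeticFunction.moebius_apply_prime hp]
        have hlog : 0 ≤ Real.log p := Real.log_nonneg (by exact_mod_cast hp.one_lt.le)
        simp [abs_of_nonneg hlog]
    _ ≤ _ := Finset.sum_le_sum_of_subset_of_nonneg (Finset.filter_subset _ _) fun _ _ _ => abs_nonneg _

/-- Chebyshev's `θ`, minus the primes below the cut-off (at most `θ(x^{1-η}) ≤ log 4 · x^{1-η}`). -/
theorem theta_sub_le_sum_log (η : ℝ) (x : ℕ) :
    Chebyshev.theta x - Real.log 4 * (x : ℝ) ^ (1 - η)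
      ≤ ∑ p ∈ (Finset.Icc 1 x).filter (fun p : ℕ => p.Prime ∧ (x : ℝ) ^ (1 - η) < (p : ℝ)), Real.log p := by
  set y : ℝ := (x : ℝ) ^ (1 - η) with hy
  have hy0 : 0 ≤ y := Real.rpow_nonneg (Nat.cast_nonneg x) _
  have hθ : Chebyshev.theta x = ∑ p ∈ (Finset.Icc 1 x).filter Nat.Prime, Real.log p := by
    rw [Chebyshev.theta, Nat.floor_natCast]; rfl
  have hsplit := Finset.sum_filter_add_sum_filter_not ((Finset.Icc 1 x).filter Nat.Prime)
    (fun p : ℕ => y < (p : ℝ)) (fun p : ℕ => Real.log p)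
  rw [Finset.filter_filter, Finset.filter_filter] at hsplit
  have hsmall : ∑ p ∈ (Finset.Icc 1 x).filter (fun p : ℕ => p.Prime ∧ ¬ y < (p : ℝ)), Real.log p
      ≤ Chebyshev.theta y := by
    rw [Chebyshev.theta]
    refine Finset.sum_le_sum_of_subset_of_nonneg ?_ fun p hp _ => ?_
    · intro p hp
      simp only [Finset.mem_filter, Finset.mem_Icc, not_lt] at hp
      simp only [Finset.mem_filter, Finset.mem_Ioc]
      exact ⟨⟨hp.1.1, Nat.le_floor hp.2.2⟩, hp.2.1⟩
    · simp only [Finset.mem_filter] at hp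
      exact Real.log_nonneg (by exact_mod_cast hp.2.one_lt.le)
  have hθy := Chebyshev.theta_le_log4_mul_x hy0
  linarith

/-- `x ↦ x^s` is `o(x)` at `+∞` for `s < 1`. -/
theorem isLittleO_rpow_self_of_lt_one {s : ℝ} (hs : s < 1) :
    (fun x : ℝ => x ^ s) =o[atTop] (fun x : ℝ => x) := by
  refine (isLittleO_iff_tendsto' ?_).2 ?_
  · filter_upwards [eventually_gt_atTop (0 : ℝ)] with x hx h using absurd h hx.ne'
  · have h := tendsto_rpow_neg_atTop (y := 1 - s) (by linarith)
    refine h.congr' ?_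
    filter_upwards [eventually_gt_atTop (0 : ℝ)] with x hx
    rw [neg_sub, Real.rpow_sub_one hx.ne']

/-- For the BH system `(X)` and EVERY `η > 0` the absolute tail is `≥ θ(x) - θ(x^{1-η}) ≫ x`:
each prime `p ∈ (x^{1-η}, x]` contributes `log p` with the same sign `μ(p) = -1`. So the `o(x)` of
the crux (true for `(X)` by the prime number theorem) comes entirely from cancellation BETWEEN prime
`n` (total `≈ -x`) and composite `n` (total `≈ +x`). -/
theorem tailSumAbs_X_not_isLittleO {η : ℝ} (hη : 0 < η) :
    ¬ (tailSumAbs ![(X : ℤ[X])] η) =o[atTop] (fun x : ℕ => (x : ℝ)) := by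
  intro h
  obtain ⟨C, hC⟩ := Chebyshev.psi_sub_theta_le_mul_sqrt
  have h1 : (fun x : ℕ => Real.log 4 * (x : ℝ) ^ (1 - η)) =o[atTop] (fun x : ℕ => (x : ℝ)) :=
    ((isLittleO_rpow_self_of_lt_one (s := 1 - η) (by linarith)).const_mul_left _).comp_tendsto
      tendsto_natCast_atTop_atTop
  have h2 : (fun x : ℕ => C * Real.sqrt x) =o[atTop] (fun x : ℕ => (x : ℝ)) := by
    have h2' := ((isLittleO_rpow_self_of_lt_one (s := 1 / 2) (by norm_num)).const_mul_left C).comp_tendsto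
      tendsto_natCast_atTop_atTop
    refine h2'.congr_left fun x => ?_
    simp [Real.sqrt_eq_rpow]
  have h3 := (h.add h1).add h2
  have h4 : (fun x : ℕ => Chebyshev.psi x) =O[atTop]
      (fun x : ℕ => tailSumAbs ![(X : ℤ[X])] η x + Real.log 4 * (x : ℝ) ^ (1 - η) + C * Real.sqrt x) := by
    refine IsBigO.of_bound 1 (Eventually.of_forall fun x => ?_)
    rw [one_mul, Real.norm_eq_abs, Real.norm_eq_abs, abs_of_nonneg (Chebyshev.psi_nonneg _)]
    refine le_trans ?_ (le_abs_self _)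
    have ha := sum_log_le_tailSumAbs_X η x
    have hb := theta_sub_le_sum_log η x
    have hc := hC x
    linarith
  have h5 := h4.trans_isLittleO h3
  exact not_isLittleO_neg_psi (by simpa using h5.neg_left)

theorem not_polyMobiusTailAbs : ¬ PolyMobiusTailAbs := fun h => by
  obtain ⟨η, hη, -, hT⟩ := h 1 ![X] isBatemanHornSystem_X
  exact tailSumAbs_X_not_isLittleO hη hT


/-! ## §2 Degenerate slice `k = 0` -/

/-- DEGENERATE CASE `k = 0` (closed, not a counterexample): the empty system is a Bateman–Horn system
and its tail vanishes identically for `x ≥ 1` whenever `η ≤ 1` (the only divisor tuple is the empty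
one, with `∏ dᵢ = 1 ≤ x^{1-η}`), so the crux holds on this slice with `η = 1/2`. -/
theorem isBatemanHornSystem_fin_zero (f : Fin 0 → ℤ[X]) : IsBatemanHornSystem f where
  irreducible i := i.elim0
  leadingCoeff_pos i := i.elim0
  pairwise_not_associated i := i.elim0
  hasNoFixedPrimeDivisor p hp := by
    unfold polyRootCountMod
    have h : ((Finset.range p).filter fun n : ℕ => (p : ℤ) ∣ ∏ i, (f i).eval (n : ℤ)) = ∅ := by
      ext n
      simp only [Finset.univ_eq_empty, Finset.prod_empty, Finset.mem_filter, Finset.mem_range,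
        Finset.notMem_empty, iff_false, not_and]
      intro _ h
      have := Int.eq_one_of_dvd_one (Int.natCast_nonneg p) h
      have := hp.one_lt
      omega
    rw [h, Finset.card_empty]; exact hp.pos

theorem tailSum_fin_zero_eq_zero (f : Fin 0 → ℤ[X]) {η : ℝ} (hη : η ≤ 1) {x : ℕ} (hx : 1 ≤ x) :
    tailSum f η x = 0 := by
  unfold tailSum
  refine Finset.sum_eq_zero fun n _ => Finset.sum_eq_zero fun d _ => ?_
  rw [if_neg]
  simp only [Finset.univ_eq_empty, Finset.prod_empty, not_lt]
  exact Real.one_le_rpow (by exact_mod_cast hx) (by linarith)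

theorem polyMobiusTail_fin_zero (f : Fin 0 → ℤ[X]) :
    ∃ η : ℝ, 0 < η ∧ η < 1 ∧ (tailSum f η) =o[atTop] (fun x : ℕ => (x : ℝ)) := by
  refine ⟨1 / 2, by norm_num, by norm_num, ?_⟩
  refine (isLittleO_zero (fun x : ℕ => (x : ℝ)) atTop).congr' ?_ EventuallyEq.rfl
  filter_upwards [eventually_ge_atTop 1] with x hx
  rw [tailSum_fin_zero_eq_zero f (by norm_num) hx]


/-! ## §3 Load-bearing analysis: the four `IsBatemanHornSystem` fields -/

/-- The crux with `pairwise_not_associated` DROPPED (the other three fields kept). -/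
def PolyMobiusTailWithoutNonAssoc : Prop :=
  ∀ (k : ℕ) (f : Fin k → ℤ[X]), (∀ i, Irreducible (f i)) → (∀ i, 0 < (f i).leadingCoeff) →
    HasNoFixedPrimeDivisor f →
      ∃ η : ℝ, 0 < η ∧ η < 1 ∧ (tailSum f η) =o[atTop] (fun x : ℕ => (x : ℝ))

/-- The witness `(X, X)` satisfies the three kept fields … -/
theorem duplicate_X_fields :
    (∀ i, Irreducible ((![X, X] : Fin 2 → ℤ[X]) i)) ∧ (∀ i, 0 < ((![X, X] : Fin 2 → ℤ[X]) i).leadingCoeff)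
      ∧ HasNoFixedPrimeDivisor (![X, X] : Fin 2 → ℤ[X]) := by
  refine ⟨fun i => ?_, fun i => ?_, fun p hp => ?_⟩
  · fin_cases i <;> simpa using Polynomial.irreducible_X
  · fin_cases i <;> simp
  · unfold polyRootCountMod
    have h : ((Finset.range p).filter fun n : ℕ => (p : ℤ) ∣ ∏ i, ((![X, X] : Fin 2 → ℤ[X]) i).eval (n : ℤ))
        = {0} := by
      ext n
      simp only [Finset.mem_filter, Finset.mem_range, Fin.prod_univ_two, Matrix.cons_val_zero,
        Matrix.cons_val_one, eval_X, Finset.mem_singleton]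
      constructor
      · rintro ⟨hn, hdvd⟩
        have hp' : Prime (p : ℤ) := Nat.prime_iff_prime_int.mp hp
        rcases hp'.dvd_or_dvd hdvd with h | h <;>
          exact Nat.eq_zero_of_dvd_of_lt (Int.natCast_dvd_natCast.mp h) hn
      · rintro rfl; exact ⟨hp.pos, by simp⟩
    rw [h, Finset.card_singleton]; exact hp.one_lt

/-- … but is NOT a Bateman–Horn system (the two coordinates are associated, indeed equal). -/
theorem not_isBatemanHornSystem_duplicate_X : ¬ IsBatemanHornSystem (![X, X] : Fin 2 → ℤ[X]) := by
  intro h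
  have := h.pairwise_not_associated (show (0 : Fin 2) ≠ 1 by decide)
  exact this (by simp)

/-- NEAR-MISS (sorry). `pairwise_not_associated` is LOAD-BEARING: for `f = (X, X)` the tail is
`∑_{n≤x} Λ(n)² - TypeI_η(x)` with `∑_{n≤x} Λ(n)² ∼ x log x` while the Type-I piece is
`x·∑_{d₁d₂ ≤ x^{1-η}} μ(d₁)μ(d₂) log d₁ log d₂ / lcm(d₁,d₂) + O(x^{1-η+ε}) ≈ ((1-η)/4)·x log x`, so
`Tail_η(x) ≈ ((3+η)/4)·x·log x ≠ o(x)` for every `η ∈ (0,1)` (numerics D at `x = 10⁶`: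
`Tail/(x log x) = 0.67, 0.75, 0.72, 0.80, 0.83, 0.85, 0.93` against the prediction
`(3+η)/4 - 1/log x = 0.69, 0.70, 0.73, 0.75, 0.80, 0.85, 0.90`, job j012719). Obstruction to a Lean proof: an elementary LOWER bound
`∑ Λ² ≥ (1/2 - o(1)) x log x` is available from Chebyshev, but the needed UPPER bound on the truncated
two-variable Möbius sum (cancellation in `∑ μ(d₁)μ(d₂) log d₁ log d₂/lcm`) is of prime-number-theorem
strength; the crude bound `x (log y)^5` loses. MECHANISM (why duplicates, and only duplicates, break it): for a pair `(g, g)` the two-variable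
density `ρ(d₁,d₂)/lcm(d₁,d₂)` has Euler factors `1 - p^{-1-s₁} - p^{-1-s₂} + p^{-1-s₁-s₂}` (every pair of
divisors is compatible), i.e. an extra factor `ζ(1+s₁+s₂)` compared with a genuine system such as
`(X, X+2)` (factors `1 - p^{-1-s₁} - p^{-1-s₂}` for odd `p`: incompatible unless `gcd ∣ 2`); on the diagonal
`s₁ = s₂ = s` of the hyperbolic truncation this is a POLE at `s = 0`, so the truncated log-weighted
singular series grows like `(1/4) log y` instead of converging to `𝔖(f)` (`∂_{s₁}∂_{s₂}[s₁s₂/(s₁+s₂)] = 1/(4s)`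
on the diagonal, `H(0,0) = 1`): `TypeI ≈ ((1-η)/4) x log x`, `Full = ∑Λ² ≈ x log x - x`,
`Tail ≈ ((3+η)/4) x log x` (numerics D: `Tail/(x log x) = 0.67…0.93`, increasing in `η`, as predicted).
Tried: restricting to `η` near `1` (Type-I range
`d₁d₂ ≤ x^ε`): still needs `(ε log x)^5 ≪ log x`, false for fixed `ε`. -/
theorem polyMobiusTail_false_without_nonAssoc : ¬ PolyMobiusTailWithoutNonAssoc := by
  sorry

/-- The crux with `hasNoFixedPrimeDivisor` DROPPED. ANALYSIS: no counterexample expected — see the module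
docstring §3 (Λ-sum `O(polylog)`, truncated singular series `→ 0`; numerics E, F). Recorded as a
definition only; "possibly unnecessary for the TAIL statement (necessary for `C(f) > 0`)". -/
def PolyMobiusTailWithoutNoFixedPrimeDivisor : Prop :=
  ∀ (k : ℕ) (f : Fin k → ℤ[X]), (∀ i, Irreducible (f i)) → (∀ i, 0 < (f i).leadingCoeff) →
    (Pairwise fun i j => ¬Associated (f i) (f j)) →
      ∃ η : ℝ, 0 < η ∧ η < 1 ∧ (tailSum f η) =o[atTop] (fun x : ℕ => (x : ℝ))

/-- The crux with `irreducible` DROPPED. ANALYSIS: no counterexample expected (products `g·h` have a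
double zero in the singular series, powers `g^m` reduce to `g`; numerics G). -/
def PolyMobiusTailWithoutIrreducible : Prop :=
  ∀ (k : ℕ) (f : Fin k → ℤ[X]), (∀ i, 0 < (f i).leadingCoeff) →
    (Pairwise fun i j => ¬Associated (f i) (f j)) → HasNoFixedPrimeDivisor f →
      ∃ η : ℝ, 0 < η ∧ η < 1 ∧ (tailSum f η) =o[atTop] (fun x : ℕ => (x : ℝ))

/-! ## §3b Guards: `leadingCoeff_pos` is decoration; the conclusion's `0 < η` is the non-triviality guard -/

/-- Crude polynomial growth along `ℕ`: `f(n) ≤ (∑ⱼ |aⱼ|) · n^{deg f}` for `n ≥ 1`, in `toNat` form. [folklore] -/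
theorem toNat_eval_le_mul_pow (g : ℤ[X]) {n : ℕ} (hn : 1 ≤ n) :
    (g.eval (n : ℤ)).toNat ≤ (∑ j ∈ Finset.range (g.natDegree + 1), (g.coeff j).natAbs) * n ^ g.natDegree := by
  rw [Int.toNat_le]
  push_cast
  rw [eval_eq_sum_range, Finset.sum_mul]
  refine le_trans (Finset.abs_sum_le_sum_abs _ _ |> le_trans (le_abs_self _)) ?_
  refine Finset.sum_le_sum fun j hj => ?_
  rw [abs_mul, abs_pow]
  refine mul_le_mul_of_nonneg_left ?_ (abs_nonneg _)
  rw [abs_of_nonneg (by positivity)]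
  exact pow_le_pow_right₀ (by exact_mod_cast hn) (Nat.lt_succ_iff.mp (Finset.mem_range.mp hj))

/-- **The conclusion's `0 < η` is the non-triviality guard.** For EVERY system `f` (no hypothesis) and
`η := -∑ᵢ deg fᵢ ≤ 0`, the crux function is eventually `0`: a divisor tuple has
`∏ dᵢ ≤ ∏ fᵢ(n) ≤ (∏ᵢ ∑ⱼ|aᵢⱼ|) · x^{∑ deg fᵢ} ≤ x^{1-η}` once `x ≥ ∏ᵢ ∑ⱼ |aᵢⱼ|`, so the bracket
`x^{1-η} < ∏ dᵢ` never holds. Hence `PolyMobiusTail` with `0 < η` dropped is trivially true. [folklore] -/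
theorem tail_eventually_eq_zero_of_eta_neg {k : ℕ} (f : Fin k → ℤ[X]) :
    ∀ᶠ x : ℕ in atTop, (∑ n ∈ Finset.Icc 1 x,
      ∑ d ∈ Fintype.piFinset (fun i => (((f i).eval (n : ℤ)).toNat).divisors),
        if (x : ℝ) ^ (1 - (-(((∑ i, (f i).natDegree : ℕ)) : ℝ))) < ∏ i, (d i : ℝ) then
          ∏ i, ((moebius (d i) : ℝ) * Real.log (d i)) else 0) = 0 := by
  set S : ℕ := ∑ i, (f i).natDegree with hS
  set B : Fin k → ℕ := fun i => ∑ j ∈ Finset.range ((f i).natDegree + 1), ((f i).coeff j).natAbs with hB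
  filter_upwards [eventually_ge_atTop (∏ i, B i), eventually_ge_atTop 1] with x hx hx1
  have hexp : (x : ℝ) ^ (1 - (-((S : ℕ) : ℝ))) = ((x ^ (S + 1) : ℕ) : ℝ) := by
    rw [sub_neg_eq_add, show (1 : ℝ) + (S : ℝ) = ((S + 1 : ℕ) : ℝ) by push_cast; ring,
      Real.rpow_natCast]
    push_cast; rfl
  refine Finset.sum_eq_zero fun n hn => Finset.sum_eq_zero fun d hd => ?_
  rw [hexp, if_neg]
  obtain ⟨hn1, hnx⟩ := Finset.mem_Icc.mp hn
  have hdi : ∀ i, d i ≤ B i * x ^ (f i).natDegree := fun i =>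
    (Nat.divisor_le (Fintype.mem_piFinset.mp hd i)).trans
      ((toNat_eval_le_mul_pow (f i) hn1).trans (Nat.mul_le_mul_left _ (Nat.pow_le_pow_left hnx _)))
  have hprod : ∏ i, d i ≤ x ^ (S + 1) := by
    calc ∏ i, d i ≤ ∏ i, (B i * x ^ (f i).natDegree) :=
          Finset.prod_le_prod' fun i _ => hdi i
      _ = (∏ i, B i) * x ^ S := by
          rw [Finset.prod_mul_distrib, Finset.prod_pow_eq_pow_sum]
      _ ≤ x * x ^ S := Nat.mul_le_mul_right _ hx
      _ = x ^ (S + 1) := by ring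
  rw [not_lt]
  exact_mod_cast hprod

/-- `PolyMobiusTail` with the constraint `0 < η` dropped holds for EVERY system (trivially, with
`η = -∑ deg fᵢ`): positivity of `η` is what makes the crux say anything. [folklore] -/
theorem polyMobiusTail_withoutEtaPos_trivial {k : ℕ} (f : Fin k → ℤ[X]) :
    ∃ η : ℝ, η < 1 ∧ (fun x : ℕ => ∑ n ∈ Finset.Icc 1 x,
      ∑ d ∈ Fintype.piFinset (fun i => (((f i).eval (n : ℤ)).toNat).divisors),
        if (x : ℝ) ^ (1 - η) < ∏ i, (d i : ℝ) then ∏ i, ((moebius (d i) : ℝ) * Real.log (d i)) else 0)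
      =o[atTop] fun x : ℕ => (x : ℝ) := by
  refine ⟨-(((∑ i, (f i).natDegree : ℕ)) : ℝ), by linarith [Nat.cast_nonneg (α := ℝ) (∑ i, (f i).natDegree)], ?_⟩
  refine (isLittleO_zero (fun x : ℕ => (x : ℝ)) atTop).congr' ?_ EventuallyEq.rfl
  filter_upwards [tail_eventually_eq_zero_of_eta_neg f] with x hx
  exact hx.symm


/-! ## §8 Positive anchor: the crux HOLDS on the slice `f = (X)` for every `η ∈ (0,1)` (PNT + Landau) -/

/-- The tail of `(X)` in closed form: `-ψ(x) - x·∑_{d ≤ x^{1-η}} μ(d) log d/d + E(x)` with the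
rounding error `E(x) = ∑_{d ≤ x^{1-η}} μ(d) log d · (x/d - ⌊x/d⌋)`. [folklore] -/
theorem tail_X_eq (η : ℝ) (x : ℕ) :
    (∑ n ∈ Finset.Icc 1 x, ∑ d ∈ Fintype.piFinset (fun i => (((![(X : ℤ[X])] i).eval (n : ℤ)).toNat).divisors),
        if (x : ℝ) ^ (1 - η) < ∏ i, (d i : ℝ) then ∏ i, ((moebius (d i) : ℝ) * Real.log (d i)) else 0)
      = -Chebyshev.psi x
        - (x : ℝ) * (∑ d ∈ Finset.Ioc 0 x, if (d : ℝ) ≤ (x : ℝ) ^ (1 - η) then (moebius d : ℝ) * Real.log d / d else 0)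
        + ∑ d ∈ Finset.Ioc 0 x, (if (d : ℝ) ≤ (x : ℝ) ^ (1 - η) then (moebius d : ℝ) * Real.log d else 0)
            * ((x : ℝ) / d - ((x / d : ℕ) : ℝ)) := by
  set y : ℝ := (x : ℝ) ^ (1 - η) with hy
  -- the truncated Möbius–log weight as an arithmetic function
  set G : ArithmeticFunction ℝ := ⟨fun d => if (d : ℝ) ≤ y then (moebius d : ℝ) * Real.log d else 0, by simp⟩
    with hG
  have hGapply : ∀ d : ℕ, G d = if (d : ℝ) ≤ y then (moebius d : ℝ) * Real.log d else 0 := fun d => rfl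
  -- Step 1: one variable
  have h1 : ∀ n : ℕ, (∑ d ∈ Fintype.piFinset (fun i => (((![(X : ℤ[X])] i).eval (n : ℤ)).toNat).divisors),
        if y < ∏ i, (d i : ℝ) then ∏ i, ((moebius (d i) : ℝ) * Real.log (d i)) else 0)
      = ∑ d ∈ n.divisors, if y < (d : ℝ) then (moebius d : ℝ) * Real.log d else 0 := by
    intro n
    simp only [Fin.prod_univ_one, Matrix.cons_val_fin_one, eval_X, Int.toNat_natCast]
    exact sum_piFinset_fin_one (fun _ => n.divisors)
      (fun j => if y < (j : ℝ) then (moebius j : ℝ) * Real.log j else 0)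
  -- Step 2: pointwise `tail_n = -Λ(n) - (G * ζ)(n)`
  have h2 : ∀ n : ℕ, (∑ d ∈ n.divisors, if y < (d : ℝ) then (moebius d : ℝ) * Real.log d else 0)
      = -vonMangoldt n - (G * ArithmeticFunction.zeta) n := by
    intro n
    rw [coe_mul_zeta_apply, ← sum_moebius_mul_log_eq, ← Finset.sum_sub_distrib]
    refine Finset.sum_congr rfl fun d _ => ?_
    rw [hGapply, ArithmeticFunction.log_apply]
    split_ifs <;> linarith
  -- Step 3: sum over `n` and swap
  have h3 : ∑ n ∈ Finset.Icc 1 x, (G * ArithmeticFunction.zeta) n = ∑ d ∈ Finset.Ioc 0 x, G d * ((x / d : ℕ) : ℝ) := by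
    rw [← sum_Ioc_mul_zeta_eq_sum G x]; rfl
  have hψ : Chebyshev.psi x = ∑ n ∈ Finset.Icc 1 x, vonMangoldt n := by
    rw [Chebyshev.psi, Nat.floor_natCast]; rfl
  simp only [h1, h2, Finset.sum_sub_distrib, Finset.sum_neg_distrib, h3, hψ, hGapply]
  rw [Finset.mul_sum]
  have : ∀ d ∈ Finset.Ioc 0 x,
      (if (d : ℝ) ≤ y then (moebius d : ℝ) * Real.log d else 0) * ((x / d : ℕ) : ℝ)
        = (x : ℝ) * (if (d : ℝ) ≤ y then (moebius d : ℝ) * Real.log d / d else 0)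
          - (if (d : ℝ) ≤ y then (moebius d : ℝ) * Real.log d else 0) * ((x : ℝ) / d - ((x / d : ℕ) : ℝ)) := by
    intro d hd
    have hd0 : (d : ℝ) ≠ 0 := by exact_mod_cast (Finset.mem_Ioc.mp hd).1.ne'
    split_ifs
    · field_simp; ring
    · simp
  rw [Finset.sum_congr rfl this, Finset.sum_sub_distrib]
  ring


/-- The truncated sum `∑_{0 < d ≤ x, d ≤ x^{1-η}} μ(d) log d / d` is the partial sum of `∑ μ(d) log d/d`
up to `⌊x^{1-η}⌋`. [folklore] -/
theorem sum_Ioc_ite_eq_sum_Icc_floor {η : ℝ} (hη : 0 ≤ η) (hη1 : η < 1) (x : ℕ) :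
    (∑ d ∈ Finset.Ioc 0 x, if (d : ℝ) ≤ (x : ℝ) ^ (1 - η) then (moebius d : ℝ) * Real.log d / d else 0)
      = ∑ d ∈ Finset.Icc 1 ⌊(x : ℝ) ^ (1 - η)⌋₊, (moebius d : ℝ) * Real.log d / d := by
  rw [← Finset.sum_filter]
  refine Finset.sum_congr ?_ fun _ _ => rfl
  ext d
  simp only [Finset.mem_filter, Finset.mem_Ioc, Finset.mem_Icc]
  have hy0 : 0 ≤ (x : ℝ) ^ (1 - η) := Real.rpow_nonneg (Nat.cast_nonneg x) _
  have hyx : (x : ℝ) ^ (1 - η) ≤ x := by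
    rcases Nat.eq_zero_or_pos x with rfl | hx
    · simp [Real.zero_rpow (by linarith : (1 : ℝ) - η ≠ 0)] 
    · exact Real.rpow_le_self_of_one_le (by exact_mod_cast hx) (by linarith)
  constructor
  · rintro ⟨⟨h0, -⟩, hdy⟩
    exact ⟨h0, Nat.le_floor hdy⟩
  · rintro ⟨h1, hdf⟩
    have hdy : (d : ℝ) ≤ (x : ℝ) ^ (1 - η) := (Nat.le_floor_iff hy0).mp hdf
    exact ⟨⟨h1, by exact_mod_cast hdy.trans hyx⟩, hdy⟩

/-- The rounding error is at most `x^{1-η} · log x`. [folklore] -/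
theorem abs_roundingError_le (η : ℝ) (x : ℕ) :
    |∑ d ∈ Finset.Ioc 0 x, (if (d : ℝ) ≤ (x : ℝ) ^ (1 - η) then (moebius d : ℝ) * Real.log d else 0)
        * ((x : ℝ) / d - ((x / d : ℕ) : ℝ))| ≤ (x : ℝ) ^ (1 - η) * Real.log x := by
  have hy0 : 0 ≤ (x : ℝ) ^ (1 - η) := Real.rpow_nonneg (Nat.cast_nonneg x) _
  calc _ ≤ ∑ d ∈ Finset.Ioc 0 x, |(if (d : ℝ) ≤ (x : ℝ) ^ (1 - η) then (moebius d : ℝ) * Real.log d else 0)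
        * ((x : ℝ) / d - ((x / d : ℕ) : ℝ))| := Finset.abs_sum_le_sum_abs _ _
    _ ≤ ∑ d ∈ Finset.Ioc 0 x, (if (d : ℝ) ≤ (x : ℝ) ^ (1 - η) then Real.log x else 0) := by
        refine Finset.sum_le_sum fun d hd => ?_
        obtain ⟨hd0, hdx⟩ := Finset.mem_Ioc.mp hd
        have hd0' : (0 : ℝ) < d := by exact_mod_cast hd0
        -- the fractional part of `x/d` lies in `[0, 1)`
        have hfrac0 : 0 ≤ (x : ℝ) / d - ((x / d : ℕ) : ℝ) := by
          rw [sub_nonneg]; exact Nat.cast_div_le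
        have hfrac1 : (x : ℝ) / d - ((x / d : ℕ) : ℝ) ≤ 1 := by
          rw [sub_le_iff_le_add, ← Nat.floor_div_eq_div (K := ℝ)]
          have := Nat.lt_floor_add_one ((x : ℝ) / d)
          linarith
        split_ifs with h
        · rw [abs_mul, abs_of_nonneg hfrac0]
          have hμ : |(moebius d : ℝ)| ≤ 1 := by exact_mod_cast abs_moebius_le_one
          have hlogd : 0 ≤ Real.log d := Real.log_nonneg (by exact_mod_cast hd0)
          have hlogx : Real.log d ≤ Real.log x :=
            Real.log_le_log hd0' (by exact_mod_cast hdx)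
          calc |(moebius d : ℝ) * Real.log d| * ((x : ℝ) / d - ((x / d : ℕ) : ℝ))
              ≤ |(moebius d : ℝ) * Real.log d| * 1 :=
                mul_le_mul_of_nonneg_left hfrac1 (abs_nonneg _)
            _ = |(moebius d : ℝ)| * Real.log d := by rw [mul_one, abs_mul, abs_of_nonneg hlogd]
            _ ≤ 1 * Real.log x := mul_le_mul hμ hlogx hlogd zero_le_one
            _ = Real.log x := one_mul _
        · simp
    _ = (((Finset.Ioc 0 x).filter fun d : ℕ => (d : ℝ) ≤ (x : ℝ) ^ (1 - η)).card : ℝ) * Real.log x := by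
        rw [← Finset.sum_filter, Finset.sum_const, nsmul_eq_mul]
    _ ≤ (x : ℝ) ^ (1 - η) * Real.log x := by
        refine mul_le_mul_of_nonneg_right ?_ (Real.log_natCast_nonneg x)
        have hsub : ((Finset.Ioc 0 x).filter fun d : ℕ => (d : ℝ) ≤ (x : ℝ) ^ (1 - η))
            ⊆ Finset.Icc 1 ⌊(x : ℝ) ^ (1 - η)⌋₊ := by
          intro d hd
          simp only [Finset.mem_filter, Finset.mem_Ioc, Finset.mem_Icc] at hd ⊢
          exact ⟨hd.1.1, Nat.le_floor hd.2⟩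
        calc (((Finset.Ioc 0 x).filter fun d : ℕ => (d : ℝ) ≤ (x : ℝ) ^ (1 - η)).card : ℝ)
            ≤ ((Finset.Icc 1 ⌊(x : ℝ) ^ (1 - η)⌋₊).card : ℝ) := by exact_mod_cast Finset.card_le_card hsub
          _ = (⌊(x : ℝ) ^ (1 - η)⌋₊ : ℝ) := by simp
          _ ≤ (x : ℝ) ^ (1 - η) := Nat.floor_le hy0

/-- **The crux holds on the prime-number-theorem slice `f = (X)`, for EVERY `η ∈ (0,1)`** (small-model
fact): `Tail_η(x) = -(ψ(x) - x) - x·(1 + ∑_{d ≤ x^{1-η}} μ(d) log d/d) + O(x^{1-η} log x) = o(x)` by the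
prime number theorem (`Literature.NumberTheory.LFunctions.chebyshevPsi_isEquivalent_holds`) and Landau's
`∑ μ(d) log d / d = -1` (`Literature.NumberTheory.LFunctions.tendsto_sum_moebius_mul_log_div`). [folklore] -/
theorem tail_X_isLittleO {η : ℝ} (hη0 : 0 < η) (hη1 : η < 1) :
    (fun x : ℕ => ∑ n ∈ Finset.Icc 1 x,
        ∑ d ∈ Fintype.piFinset (fun i => (((![(X : ℤ[X])] i).eval (n : ℤ)).toNat).divisors),
          if (x : ℝ) ^ (1 - η) < ∏ i, (d i : ℝ) then ∏ i, ((moebius (d i) : ℝ) * Real.log (d i)) else 0)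
      =o[atTop] (fun x : ℕ => (x : ℝ)) := by
  -- T1: ψ(x) - x = o(x)
  have T1 : (fun x : ℕ => Chebyshev.psi x - x) =o[atTop] (fun x : ℕ => (x : ℝ)) :=
    (Literature.NumberTheory.LFunctions.chebyshevPsi_isEquivalent_holds.isLittleO).comp_tendsto
      tendsto_natCast_atTop_atTop
  -- T2: x · (1 + partial sum up to ⌊x^{1-η}⌋) = o(x)
  have hfloor : Tendsto (fun x : ℕ => ⌊(x : ℝ) ^ (1 - η)⌋₊) atTop atTop :=
    tendsto_nat_floor_atTop.comp ((tendsto_rpow_atTop (by linarith)).comp tendsto_natCast_atTop_atTop)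
  have hL : Tendsto (fun x : ℕ => 1 + ∑ d ∈ Finset.Icc 1 ⌊(x : ℝ) ^ (1 - η)⌋₊,
      (moebius d : ℝ) * Real.log d / d) atTop (nhds 0) := by
    have := (Literature.NumberTheory.LFunctions.tendsto_sum_moebius_mul_log_div.comp hfloor).const_add 1
    simpa using this
  have T2 : (fun x : ℕ => (x : ℝ) * (1 + ∑ d ∈ Finset.Icc 1 ⌊(x : ℝ) ^ (1 - η)⌋₊,
      (moebius d : ℝ) * Real.log d / d)) =o[atTop] (fun x : ℕ => (x : ℝ)) := by
    have h := (isBigO_refl (fun x : ℕ => (x : ℝ)) atTop).mul_isLittleO ((isLittleO_one_iff ℝ).mpr hL)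
    simpa using h
  -- T3: the rounding error is O(x^{1-η} log x) = o(x)
  have T3' : (fun x : ℝ => x ^ (1 - η) * Real.log x) =o[atTop] (fun x : ℝ => x) := by
    have h := (isBigO_refl (fun x : ℝ => x ^ (1 - η)) atTop).mul_isLittleO (isLittleO_log_rpow_atTop hη0)
    refine h.congr' EventuallyEq.rfl ?_
    filter_upwards [eventually_gt_atTop (0 : ℝ)] with x hx
    rw [← Real.rpow_add hx, sub_add_cancel, Real.rpow_one]
  have T3 : (fun x : ℕ => ∑ d ∈ Finset.Ioc 0 x, (if (d : ℝ) ≤ (x : ℝ) ^ (1 - η) then (moebius d : ℝ) * Real.log d else 0)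
        * ((x : ℝ) / d - ((x / d : ℕ) : ℝ))) =o[atTop] (fun x : ℕ => (x : ℝ)) := by
    refine IsBigO.trans_isLittleO ?_ (T3'.comp_tendsto tendsto_natCast_atTop_atTop)
    refine IsBigO.of_bound 1 (Eventually.of_forall fun x => ?_)
    rw [one_mul, Real.norm_eq_abs, Function.comp_apply, Real.norm_eq_abs]
    exact (abs_roundingError_le η x).trans (le_abs_self _)
  -- assemble
  have h := (T1.neg_left.sub T2).add T3
  refine h.congr' (Eventually.of_forall fun x => ?_) EventuallyEq.rfl
  beta_reduce
  rw [tail_X_eq η x, sum_Ioc_ite_eq_sum_Icc_floor hη0.le hη1 x]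
  ring


/-! ## §5(3) Natural strengthening 3 (refuted): prime divisor tuples only -/

/-- The PRIME-divisor tail of `(X)` in closed form: restricting the divisor tuples to prime `d` gives
`∑_{n ≤ x} ∑_{p ∣ n, y < p} μ(p) log p = -∑_{y < p ≤ x} log p · ⌊x/p⌋`. [folklore] -/
theorem primeTail_X_eq (η : ℝ) (x : ℕ) :
    (∑ n ∈ Finset.Icc 1 x, ∑ d ∈ Fintype.piFinset (fun i => (((![(X : ℤ[X])] i).eval (n : ℤ)).toNat).primeFactors),
        if (x : ℝ) ^ (1 - η) < ∏ i, (d i : ℝ) then ∏ i, ((moebius (d i) : ℝ) * Real.log (d i)) else 0)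
      = -∑ d ∈ Finset.Ioc 0 x, (if d.Prime ∧ (x : ℝ) ^ (1 - η) < d then Real.log d else 0) * ((x / d : ℕ) : ℝ) := by
  set y : ℝ := (x : ℝ) ^ (1 - η) with hy
  set H : ArithmeticFunction ℝ := ⟨fun d => if d.Prime ∧ y < d then Real.log d else 0, by simp [Nat.not_prime_zero]⟩
    with hH
  have hHapply : ∀ d : ℕ, H d = if d.Prime ∧ y < d then Real.log d else 0 := fun d => rfl
  have h1 : ∀ n : ℕ, (∑ d ∈ Fintype.piFinset (fun i => (((![(X : ℤ[X])] i).eval (n : ℤ)).toNat).primeFactors),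
        if y < ∏ i, (d i : ℝ) then ∏ i, ((moebius (d i) : ℝ) * Real.log (d i)) else 0)
      = -(H * ArithmeticFunction.zeta) n := by
    intro n
    simp only [Fin.prod_univ_one, Matrix.cons_val_fin_one, eval_X, Int.toNat_natCast]
    rw [sum_piFinset_fin_one (fun _ => n.primeFactors)
      (fun j => if y < (j : ℝ) then (moebius j : ℝ) * Real.log j else 0), coe_mul_zeta_apply]
    have hpf : n.primeFactors = n.divisors.filter Nat.Prime := by
      ext p; simp [Nat.mem_primeFactors, Nat.mem_divisors, and_comm, and_left_comm]
    rw [hpf, Finset.sum_filter, ← Finset.sum_neg_distrib]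
    refine Finset.sum_congr rfl fun d hd => ?_
    rw [hHapply]
    by_cases hp : d.Prime
    · simp only [hp, true_and, if_true, ArithmeticFunction.moebius_apply_prime hp]
      split_ifs <;> simp
    · simp [hp]
  have h3 : ∑ n ∈ Finset.Icc 1 x, (H * ArithmeticFunction.zeta) n
      = ∑ d ∈ Finset.Ioc 0 x, H d * ((x / d : ℕ) : ℝ) := by
    rw [← sum_Ioc_mul_zeta_eq_sum H x]; rfl
  simp only [h1, Finset.sum_neg_distrib, h3, hHapply]

/-- Mertens' first theorem (tree: `abs_mertensTau_le`) bounds the prime-divisor tail of `(X)` from below: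
`∑_{y < p ≤ x} log p ⌊x/p⌋ ≥ x (η log x - 8 - log 4)` for `y = x^{1-η}`, `0 < η ≤ 1`, `x ≥ 1`. [folklore] -/
theorem primeTail_X_lower {η : ℝ} (hη0 : 0 < η) (hη1 : η ≤ 1) {x : ℕ} (hx : 1 ≤ x) :
    (x : ℝ) * (η * Real.log x - 8 - Real.log 4)
      ≤ ∑ d ∈ Finset.Ioc 0 x, (if d.Prime ∧ (x : ℝ) ^ (1 - η) < d then Real.log d else 0) * ((x / d : ℕ) : ℝ) := by
  set y : ℝ := (x : ℝ) ^ (1 - η) with hy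
  have hx0 : (0 : ℝ) < x := by exact_mod_cast hx
  have hx1 : (1 : ℝ) ≤ x := by exact_mod_cast hx
  have hy1 : 1 ≤ y := Real.one_le_rpow hx1 (by linarith)
  have hy0 : 0 ≤ y := by linarith
  have hyx : y ≤ x := Real.rpow_le_self_of_one_le hx1 (by linarith)
  have hlogy : Real.log y = (1 - η) * Real.log x := Real.log_rpow hx0 _
  -- (i) replace `⌊x/d⌋` by `x/d - 1`
  have step1 : ∑ d ∈ Finset.Ioc 0 x, (if d.Prime ∧ y < d then Real.log d else 0) * ((x : ℝ) / d - 1)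
      ≤ ∑ d ∈ Finset.Ioc 0 x, (if d.Prime ∧ y < d then Real.log d else 0) * ((x / d : ℕ) : ℝ) := by
    refine Finset.sum_le_sum fun d hd => ?_
    have hd1 : 1 ≤ d := (Finset.mem_Ioc.mp hd).1
    have hw : 0 ≤ (if d.Prime ∧ y < d then Real.log d else 0) := by
      split_ifs
      · exact Real.log_nonneg (by exact_mod_cast hd1)
      · exact le_rfl
    refine mul_le_mul_of_nonneg_left ?_ hw
    rw [← Nat.floor_div_eq_div (K := ℝ)]
    exact (Nat.sub_one_lt_floor _).le
  -- (ii) the two pieces of the left side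
  have hsplit : ∑ d ∈ Finset.Ioc 0 x, (if d.Prime ∧ y < d then Real.log d else 0) * ((x : ℝ) / d - 1)
      = (x : ℝ) * ∑ d ∈ Finset.Ioc 0 x, (if d.Prime ∧ y < d then Real.log d / d else 0)
        - ∑ d ∈ Finset.Ioc 0 x, (if d.Prime ∧ y < d then Real.log d else 0) := by
    rw [Finset.mul_sum, ← Finset.sum_sub_distrib]
    refine Finset.sum_congr rfl fun d hd => ?_
    have hd0 : (d : ℝ) ≠ 0 := by exact_mod_cast (Finset.mem_Ioc.mp hd).1.ne'
    split_ifs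
    · field_simp
    · simp
  -- (iii) the `log p / p` sum is `S(x) - S(y)` with `S = primeLogDivSum`
  have hS : ∑ d ∈ Finset.Ioc 0 x, (if d.Prime ∧ y < d then Real.log d / d else 0)
      = Literature.NumberTheory.LFunctions.Mertens.primeLogDivSum x
        - Literature.NumberTheory.LFunctions.Mertens.primeLogDivSum y := by
    rw [Literature.NumberTheory.LFunctions.Mertens.primeLogDivSum, Literature.NumberTheory.LFunctions.Mertens.primeLogDivSum,
      Nat.floor_natCast, ← Finset.sum_filter]
    have hA : (Finset.Ioc 0 x).filter (fun d : ℕ => d.Prime ∧ y < d) = (Nat.primesLE x).filter (fun p : ℕ => y < p) := by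
      ext d
      simp only [Finset.mem_filter, Finset.mem_Ioc, Nat.mem_primesLE]
      constructor
      · rintro ⟨⟨-, hdx⟩, hp, hyd⟩; exact ⟨⟨hdx, hp⟩, hyd⟩
      · rintro ⟨⟨hdx, hp⟩, hyd⟩; exact ⟨⟨hp.pos, hdx⟩, hp, hyd⟩
    have hB : (Nat.primesLE x).filter (fun p : ℕ => ¬ y < p) = Nat.primesLE ⌊y⌋₊ := by
      ext p
      simp only [Finset.mem_filter, Nat.mem_primesLE, not_lt]
      constructor
      · rintro ⟨⟨-, hp⟩, hpy⟩; exact ⟨Nat.le_floor hpy, hp⟩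
      · rintro ⟨hpf, hp⟩
        have hpy : (p : ℝ) ≤ y := (Nat.le_floor_iff hy0).mp hpf
        exact ⟨⟨by exact_mod_cast hpy.trans hyx, hp⟩, hpy⟩
    rw [hA, ← hB]
    have := Finset.sum_filter_add_sum_filter_not (Nat.primesLE x) (fun p : ℕ => y < p)
      (fun p : ℕ => Real.log p / p)
    linarith
  -- (iv) Mertens at `x` and at `y`
  have hMx := Literature.NumberTheory.LFunctions.Mertens.abs_mertensTau_le hx1
  have hMy := Literature.NumberTheory.LFunctions.Mertens.abs_mertensTau_le hy1
  rw [Literature.NumberTheory.LFunctions.Mertens.mertensTau, abs_le] at hMx hMy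
  -- (v) the `log p` sum is at most `θ(x) ≤ x log 4`
  have hθ : ∑ d ∈ Finset.Ioc 0 x, (if d.Prime ∧ y < d then Real.log d else 0) ≤ Real.log 4 * x := by
    refine le_trans ?_ (Chebyshev.theta_le_log4_mul_x hx0.le)
    rw [Chebyshev.theta, Nat.floor_natCast, Finset.sum_filter]
    refine Finset.sum_le_sum fun d hd => ?_
    have hd1 : 1 ≤ d := (Finset.mem_Ioc.mp hd).1
    have hlog : 0 ≤ Real.log d := Real.log_nonneg (by exact_mod_cast hd1)
    split_ifs with h1 h2 h2 <;> first | exact le_rfl | exact hlog | exact absurd h1.1 h2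
  -- assemble
  refine le_trans ?_ step1
  rw [hsplit, hS]
  rw [hlogy] at hMy
  nlinarith [hMx.1, hMy.2, hθ, hx0]

/-- **The prime-divisor restriction of `PolyMobiusTail` fails for `(X)` at EVERY `η ∈ (0,1)`**: keeping
only prime `d` in the divisor sum leaves `-∑_{x^{1-η} < p ≤ x} log p ⌊x/p⌋ ≈ -η·x·log x`. So the
cancellation in the crux also runs across the divisor lattice (prime against composite `d`), not only
across `n`. [folklore] -/
theorem primeTail_X_not_isLittleO {η : ℝ} (hη0 : 0 < η) (hη1 : η < 1) :
    ¬ (fun x : ℕ => ∑ n ∈ Finset.Icc 1 x,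
        ∑ d ∈ Fintype.piFinset (fun i => (((![(X : ℤ[X])] i).eval (n : ℤ)).toNat).primeFactors),
          if (x : ℝ) ^ (1 - η) < ∏ i, (d i : ℝ) then ∏ i, ((moebius (d i) : ℝ) * Real.log (d i)) else 0)
      =o[atTop] (fun x : ℕ => (x : ℝ)) := by
  intro h
  have hev := h.def one_pos
  have hlog : ∀ᶠ x : ℕ in atTop, 10 + Real.log 4 ≤ η * Real.log x := by
    have ht : Tendsto (fun x : ℕ => η * Real.log x) atTop atTop :=
      (Real.tendsto_log_atTop.comp tendsto_natCast_atTop_atTop).const_mul_atTop hη0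
    exact ht.eventually_ge_atTop _
  obtain ⟨x, hx, hlx, hx1⟩ := (hev.and (hlog.and (eventually_ge_atTop 1))).exists
  rw [primeTail_X_eq, norm_neg, Real.norm_eq_abs, Real.norm_eq_abs, one_mul,
    abs_of_nonneg (Nat.cast_nonneg x : (0 : ℝ) ≤ (x : ℝ))] at hx
  have hlow := primeTail_X_lower hη0 hη1.le hx1
  have hx0 : (1 : ℝ) ≤ x := by exact_mod_cast hx1
  have := le_trans hlow (le_abs_self _)
  nlinarith

/-- **NATURAL STRENGTHENING 3 (refuted): prime divisor tuples only.** [folklore] -/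
theorem polyMobiusTail_primeDivisors_false :
    ¬ ∀ (k : ℕ) (f : Fin k → ℤ[X]), IsBatemanHornSystem f → ∃ η : ℝ, 0 < η ∧ η < 1 ∧
      (fun x : ℕ => ∑ n ∈ Finset.Icc 1 x,
        ∑ d ∈ Fintype.piFinset (fun i => (((f i).eval (n : ℤ)).toNat).primeFactors),
          if (x : ℝ) ^ (1 - η) < ∏ i, (d i : ℝ) then ∏ i, ((moebius (d i) : ℝ) * Real.log (d i)) else 0)
      =o[atTop] (fun x : ℕ => (x : ℝ)) := fun h => by
  obtain ⟨η, hη0, hη1, hT⟩ := h 1 ![X] isBatemanHornSystem_X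
  exact primeTail_X_not_isLittleO hη0 hη1 hT


/-! ## §4b The endpoint `η = 1` in general: Type-I empty, tail = `(-1)^k ∑∏Λ` -/

/-- At the endpoint `η = 1` the Type-I piece is EMPTY for `k ≥ 1`: `∏ dᵢ ≤ x⁰ = 1` forces every `dᵢ = 1`,
whose weight `∏ μ(1) log 1` vanishes. [folklore] -/
theorem typeI_one_eq_zero {k : ℕ} (hk : 0 < k) (f : Fin k → ℤ[X]) (x : ℕ) :
    (∑ n ∈ Finset.Icc 1 x, ∑ d ∈ Fintype.piFinset (fun i => (((f i).eval (n : ℤ)).toNat).divisors),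
        if ∏ i, (d i : ℝ) ≤ (x : ℝ) ^ (1 - (1 : ℝ)) then ∏ i, ((moebius (d i) : ℝ) * Real.log (d i)) else 0) = 0 := by
  refine Finset.sum_eq_zero fun n _ => Finset.sum_eq_zero fun d hd => ?_
  split_ifs with h
  · -- every coordinate is `1`
    rw [sub_self, Real.rpow_zero] at h
    have hd1 : ∀ i, 1 ≤ d i := fun i =>
      Nat.pos_of_mem_divisors (Fintype.mem_piFinset.mp hd i)
    have hall : ∀ i, d i = 1 := by
      by_contra hne
      push Not at hne
      obtain ⟨j, hj⟩ := hne
      have hj2 : 2 ≤ d j := lt_of_le_of_ne (hd1 j) (Ne.symm hj)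
      have hprodN : 2 ≤ ∏ i, d i :=
        hj2.trans (Finset.single_le_prod' (fun i _ => hd1 i) (Finset.mem_univ j))
      have hprod : (2 : ℝ) ≤ ∏ i, (d i : ℝ) := by exact_mod_cast hprodN
      linarith
    refine Finset.prod_eq_zero (Finset.mem_univ (⟨0, hk⟩ : Fin k)) ?_
    simp [hall]
  · rfl


/-- **The endpoint `η = 1` is the full `Λ`-sum** for every system with `k ≥ 1`:
`tailSum f 1 x = (-1)^k · lambdaSum f x`. For a BH system closing the `η`-range at `1` would assert
`∑ ∏ Λ(fᵢ(n)) = o(x)`, the negation of Bateman–Horn. [folklore] -/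
theorem tailSum_one_eq {k : ℕ} (hk : 0 < k) (f : Fin k → ℤ[X]) (x : ℕ) :
    tailSum f 1 x = (-1 : ℝ) ^ k * lambdaSum f x := by
  have h0 : typeISum f 1 x = 0 := typeI_one_eq_zero hk f x
  rw [lambdaSum_eq_typeI_add_tail f 1 x, h0, zero_add, ← mul_assoc, ← pow_add, ← two_mul, pow_mul,
    neg_one_sq, one_pow, one_mul]

/-! ## §0b The `k = 1` slice in counted form (bridge to Λ over polynomial values + root-class counts) -/

/-- **The `k = 1` slice in counted form.** For one polynomial `g`, every real `η` and every `x`: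
`Tail_η(g; x) = -∑_{n ≤ x} Λ(g(n)) - ∑_{d ≤ x^{1-η}} μ(d) log d · #{n ≤ x : d ∣ g(n), g(n) ≥ 1}`
(values `g(n) ≤ 0` are sent to `0` by `Int.toNat` and carry no divisors). This is the bridge from the
crux to "`Λ` over the values of `g`" plus root-class counts `#{n ≤ x : d ∣ g(n)}` of level `x^{1-η}`
(the Type-I side, cf. `TypeIMainTerm`). [folklore] -/
theorem tail_fin_one_eq_counted (g : ℤ[X]) (η : ℝ) (x : ℕ) :
    (∑ n ∈ Finset.Icc 1 x, ∑ d ∈ Fintype.piFinset (fun i => (((![g] i).eval (n : ℤ)).toNat).divisors),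
        if (x : ℝ) ^ (1 - η) < ∏ i, (d i : ℝ) then ∏ i, ((moebius (d i) : ℝ) * Real.log (d i)) else 0)
      = -(∑ n ∈ Finset.Icc 1 x, vonMangoldt ((g.eval (n : ℤ)).toNat))
        - ∑ d ∈ Finset.Icc 1 ⌊(x : ℝ) ^ (1 - η)⌋₊, (moebius d : ℝ) * Real.log d *
            (((Finset.Icc 1 x).filter (fun n : ℕ => d ∣ (g.eval (n : ℤ)).toNat ∧ (g.eval (n : ℤ)).toNat ≠ 0)).card : ℝ) := by
  set y : ℝ := (x : ℝ) ^ (1 - η) with hy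
  have hy0 : 0 ≤ y := Real.rpow_nonneg (Nat.cast_nonneg x) _
  -- one variable
  have h1 : ∀ n : ℕ, (∑ d ∈ Fintype.piFinset (fun i => (((![g] i).eval (n : ℤ)).toNat).divisors),
        if y < ∏ i, (d i : ℝ) then ∏ i, ((moebius (d i) : ℝ) * Real.log (d i)) else 0)
      = ∑ d ∈ ((g.eval (n : ℤ)).toNat).divisors, if y < (d : ℝ) then (moebius d : ℝ) * Real.log d else 0 := by
    intro n
    simp only [Fin.prod_univ_one, Matrix.cons_val_fin_one]
    exact sum_piFinset_fin_one (fun _ => ((g.eval (n : ℤ)).toNat).divisors)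
      (fun j => if y < (j : ℝ) then (moebius j : ℝ) * Real.log j else 0)
  -- pointwise: tail_n = -Λ(m) - ∑_{d ≤ ⌊y⌋} μ(d) log d · [d ∣ m, m ≠ 0]
  have h2 : ∀ m : ℕ, (∑ d ∈ m.divisors, if y < (d : ℝ) then (moebius d : ℝ) * Real.log d else 0)
      = -vonMangoldt m - ∑ d ∈ Finset.Icc 1 ⌊y⌋₊,
          if d ∣ m ∧ m ≠ 0 then (moebius d : ℝ) * Real.log d else 0 := by
    intro m
    rw [← sum_moebius_mul_log_eq]
    -- split the divisor sum at `y`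
    have hsplit := Finset.sum_filter_add_sum_filter_not m.divisors (fun d : ℕ => y < (d : ℝ))
      (fun d : ℕ => (moebius d : ℝ) * Real.log d)
    rw [← Finset.sum_filter]
    have hsmall : ∑ d ∈ m.divisors.filter (fun d : ℕ => ¬ y < (d : ℝ)), (moebius d : ℝ) * Real.log d
        = ∑ d ∈ Finset.Icc 1 ⌊y⌋₊, if d ∣ m ∧ m ≠ 0 then (moebius d : ℝ) * Real.log d else 0 := by
      rw [← Finset.sum_filter]
      refine Finset.sum_congr ?_ fun _ _ => rfl
      ext d
      simp only [Finset.mem_filter, Nat.mem_divisors, Finset.mem_Icc, not_lt]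
      constructor
      · rintro ⟨⟨hdm, hm⟩, hdy⟩
        exact ⟨⟨Nat.pos_of_dvd_of_pos hdm (Nat.pos_of_ne_zero hm), Nat.le_floor hdy⟩, hdm, hm⟩
      · rintro ⟨⟨-, hdf⟩, hdm, hm⟩
        exact ⟨⟨hdm, hm⟩, (Nat.le_floor_iff hy0).mp hdf⟩
    simp only [ArithmeticFunction.log_apply] at hsplit ⊢
    linarith [hsmall]
  simp only [h1, h2, Finset.sum_sub_distrib, Finset.sum_neg_distrib]
  congr 1
  rw [Finset.sum_comm]
  refine Finset.sum_congr rfl fun d _ => ?_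
  rw [← Finset.sum_filter, Finset.sum_const, nsmul_eq_mul, mul_comm]


/-! ## §1b `∃ η` versus `∀ η` is immaterial modulo `TypeIMainTerm` -/

/-- Explicit-sum form of `lambdaSum_eq_typeI_add_tail` (no `def`s unfolded). [folklore] -/
theorem sum_prod_vonMangoldt_eq_typeI_add_tail' {k : ℕ} (f : Fin k → ℤ[X]) (η : ℝ) (x : ℕ) :
    (∑ n ∈ Finset.Icc 1 x, ∏ i, vonMangoldt (((f i).eval (n : ℤ)).toNat))
      = (-1 : ℝ) ^ k * ((∑ n ∈ Finset.Icc 1 x,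
          ∑ d ∈ Fintype.piFinset (fun i => (((f i).eval (n : ℤ)).toNat).divisors),
            if ∏ i, (d i : ℝ) ≤ (x : ℝ) ^ (1 - η) then ∏ i, ((moebius (d i) : ℝ) * Real.log (d i)) else 0)
        + (∑ n ∈ Finset.Icc 1 x,
          ∑ d ∈ Fintype.piFinset (fun i => (((f i).eval (n : ℤ)).toNat).divisors),
            if (x : ℝ) ^ (1 - η) < ∏ i, (d i : ℝ) then ∏ i, ((moebius (d i) : ℝ) * Real.log (d i)) else 0)) := by
  have hΛ : ∀ m : ℕ, vonMangoldt m = -∑ e ∈ m.divisors, ((moebius e : ℝ) * Real.log e) := by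
    intro m
    have h := sum_moebius_mul_log_eq (n := m)
    simp only [ArithmeticFunction.log_apply] at h
    linarith
  have stepA : ∀ n : ℕ, (∏ i, vonMangoldt (((f i).eval (n : ℤ)).toNat))
      = (-1 : ℝ) ^ k * ∑ d ∈ Fintype.piFinset (fun i => (((f i).eval (n : ℤ)).toNat).divisors),
          ∏ i, ((moebius (d i) : ℝ) * Real.log (d i)) := by
    intro n
    simp_rw [hΛ]
    rw [Finset.prod_neg, Finset.card_univ, Fintype.card_fin, Finset.prod_univ_sum]
  have stepB : ∀ n : ℕ,
      (∑ d ∈ Fintype.piFinset (fun i => (((f i).eval (n : ℤ)).toNat).divisors),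
          ∏ i, ((moebius (d i) : ℝ) * Real.log (d i)))
      = (∑ d ∈ Fintype.piFinset (fun i => (((f i).eval (n : ℤ)).toNat).divisors),
          if ∏ i, (d i : ℝ) ≤ (x : ℝ) ^ (1 - η) then ∏ i, ((moebius (d i) : ℝ) * Real.log (d i)) else 0)
        + (∑ d ∈ Fintype.piFinset (fun i => (((f i).eval (n : ℤ)).toNat).divisors),
          if (x : ℝ) ^ (1 - η) < ∏ i, (d i : ℝ) then ∏ i, ((moebius (d i) : ℝ) * Real.log (d i)) else 0) := by
    intro n
    rw [← Finset.sum_add_distrib]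
    refine Finset.sum_congr rfl fun d _ => ?_
    by_cases h : ∏ i, (d i : ℝ) ≤ (x : ℝ) ^ (1 - η)
    · rw [if_pos h, if_neg (not_lt.mpr h), add_zero]
    · rw [if_neg h, if_pos (not_le.mp h), zero_add]
  rw [← Finset.sum_add_distrib, Finset.mul_sum]
  refine Finset.sum_congr rfl fun n _ => ?_
  rw [stepA n, stepB n]

/-- If the `Λ`-sum of a system satisfies `∑_{n≤x} ∏ Λ(fᵢ(n)) ∼ C·x` with the SAME constant as its Type-I
main term at `η`, then the tail at `η` is `o(x)` (subtract two `∼ C x` asymptotics). [folklore] -/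
theorem tail_isLittleO_of_isEquivalent {k : ℕ} (f : Fin k → ℤ[X]) {η C : ℝ}
    (hL : (fun x : ℕ => ∑ n ∈ Finset.Icc 1 x, ∏ i, vonMangoldt (((f i).eval (n : ℤ)).toNat))
      ~[atTop] (fun x : ℕ => C * (x : ℝ)))
    (hM : (fun x : ℕ => (-1 : ℝ) ^ k * ∑ n ∈ Finset.Icc 1 x,
      ∑ d ∈ Fintype.piFinset (fun i => (((f i).eval (n : ℤ)).toNat).divisors),
        if ∏ i, (d i : ℝ) ≤ (x : ℝ) ^ (1 - η) then ∏ i, ((moebius (d i) : ℝ) * Real.log (d i)) else 0)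
      ~[atTop] (fun x : ℕ => C * (x : ℝ))) :
    (fun x : ℕ => ∑ n ∈ Finset.Icc 1 x,
      ∑ d ∈ Fintype.piFinset (fun i => (((f i).eval (n : ℤ)).toNat).divisors),
        if (x : ℝ) ^ (1 - η) < ∏ i, (d i : ℝ) then ∏ i, ((moebius (d i) : ℝ) * Real.log (d i)) else 0)
      =o[atTop] (fun x : ℕ => (x : ℝ)) := by
  have hA := hL.isLittleO.trans_isBigO (isBigO_const_mul_self C (fun x : ℕ => (x : ℝ)) atTop)
  have hB := hM.isLittleO.trans_isBigO (isBigO_const_mul_self C (fun x : ℕ => (x : ℝ)) atTop)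
  have hC := (hA.sub hB).const_mul_left ((-1 : ℝ) ^ k)
  refine hC.congr_left fun x => ?_
  simp only [Pi.sub_apply]
  rw [sum_prod_vonMangoldt_eq_typeI_add_tail' f η x]
  have h1 : ((-1 : ℝ) ^ k) ^ 2 = 1 := by rw [← pow_mul, mul_comm, pow_mul, neg_one_sq, one_pow]
  linear_combination (∑ n ∈ Finset.Icc 1 x,
        ∑ d ∈ Fintype.piFinset (fun i => (((f i).eval (n : ℤ)).toNat).divisors),
          if (x : ℝ) ^ (1 - η) < ∏ i, (d i : ℝ) then ∏ i, ((moebius (d i) : ℝ) * Real.log (d i)) else 0) * h1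

/-- **`∃ η` versus `∀ η` is immaterial modulo `TypeIMainTerm`**: assuming the theorem-grade Type-I main
term, `PolyMobiusTail` (some `η ∈ (0,1)` per system) already implies the tail bound for EVERY
`η ∈ (0,1)` — the truth value does not depend on `η` inside the open interval; the only boundary
phenomenon is the closed endpoint `η = 1` (`Negative/CancellationAcrossN.lean`). [folklore] -/
theorem polyMobiusTail_iff_forall_eta (hMain : TypeIMainTerm) :
    PolyMobiusTail ↔ ∀ (k : ℕ) (f : Fin k → ℤ[X]), IsBatemanHornSystem f → ∀ η : ℝ, 0 < η → η < 1 →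
      (fun x : ℕ => ∑ n ∈ Finset.Icc 1 x,
        ∑ d ∈ Fintype.piFinset (fun i => (((f i).eval (n : ℤ)).toNat).divisors),
          if (x : ℝ) ^ (1 - η) < ∏ i, (d i : ℝ) then ∏ i, ((moebius (d i) : ℝ) * Real.log (d i)) else 0)
        =o[atTop] fun x : ℕ => (x : ℝ) := by
  constructor
  · intro hTail k f hf η hη0 hη1
    -- first extract the Λ-asymptotic from the crux at its own η₀
    obtain ⟨η₀, h0, h1, hT⟩ := hTail k f hf
    obtain ⟨C₀, hC₀, hHas₀, hM₀⟩ := hMain k f hf η₀ h0 h1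
    have hB := (hT.const_mul_left ((-1 : ℝ) ^ k)).trans_isBigO
      (isBigO_self_const_mul hC₀.ne' (fun x : ℕ => (x : ℝ)) atTop)
    have hL : (fun x : ℕ => ∑ n ∈ Finset.Icc 1 x, ∏ i, vonMangoldt (((f i).eval (n : ℤ)).toNat))
        ~[atTop] (fun x : ℕ => C₀ * (x : ℝ)) := by
      refine (hM₀.add_isLittleO hB).congr_left (Eventually.of_forall fun x => ?_)
      simp only [Pi.add_apply]
      rw [sum_prod_vonMangoldt_eq_typeI_add_tail' f η₀ x, mul_add]
    -- then subtract at the requested η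
    obtain ⟨C, -, hHas, hM⟩ := hMain k f hf η hη0 hη1
    have hCC : C₀ = C := tendsto_nhds_unique hHas₀ hHas
    subst hCC
    exact tail_isLittleO_of_isEquivalent f hL hM
  · intro h k f hf
    exact ⟨1 / 2, by norm_num, by norm_num, h k f hf (1 / 2) (by norm_num) (by norm_num)⟩


/-! ## §1c One side of the crux already yields prime tuples (lower half = qualitative BH; both halves parity-blocked) -/

/-- **One side of the crux already yields prime tuples.** Assume the theorem-grade `TypeIMainTerm`. If for a
BH system the signed tail `(-1)^k · Tail_η` is merely bounded BELOW by `-(1-δ)·C(f)·x` eventually (instead of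
being `o(x)`), then `∑_{n ≤ x} ∏ Λ(fᵢ(n)) ≥ (δ/2)·C(f)·x` eventually — in particular infinitely many `n`
make every `fᵢ(n)` a prime power. So the "lower" half of `PolyMobiusTail` is the qualitative Hardy–Littlewood /
Bateman–Horn conjecture (lower-bound sieve problem), the "upper" half the asymptotic upper bound; both halves
are parity-blocked (Bombieri's factor-`2` indeterminacy covers exactly this two-sided gap). [folklore] -/
theorem sum_prod_vonMangoldt_lower_of_tail_lower (hMain : TypeIMainTerm) {k : ℕ} {f : Fin k → ℤ[X]}
    (hf : IsBatemanHornSystem f) {η : ℝ} (hη0 : 0 < η) (hη1 : η < 1) {δ : ℝ} (hδ : 0 < δ)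
    (hlow : ∀ᶠ x : ℕ in atTop, -(1 - δ) * batemanHornConst f * (x : ℝ)
      ≤ (-1 : ℝ) ^ k * ∑ n ∈ Finset.Icc 1 x,
          ∑ d ∈ Fintype.piFinset (fun i => (((f i).eval (n : ℤ)).toNat).divisors),
            if (x : ℝ) ^ (1 - η) < ∏ i, (d i : ℝ) then ∏ i, ((moebius (d i) : ℝ) * Real.log (d i)) else 0) :
    ∀ᶠ x : ℕ in atTop, δ / 2 * batemanHornConst f * (x : ℝ)
      ≤ ∑ n ∈ Finset.Icc 1 x, ∏ i, vonMangoldt (((f i).eval (n : ℤ)).toNat) := by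
  obtain ⟨C, hC, hHas, hM⟩ := hMain k f hf η hη0 hη1
  have hCeq : batemanHornConst f = C := hHas.batemanHornConst_eq
  rw [hCeq] at hlow ⊢
  -- from `(-1)^k TypeI ∼ C x`: eventually `(-1)^k TypeI ≥ (1 - δ/2) C x`
  have hM' := hM.isLittleO.def (half_pos hδ)
  filter_upwards [hlow, hM', eventually_ge_atTop 1] with x hlo hup hx1
  rw [Pi.sub_apply, Real.norm_eq_abs, Real.norm_eq_abs, abs_of_pos (by positivity : 0 < C * (x : ℝ))] at hup
  have hup' := (abs_le.mp hup).1
  rw [sum_prod_vonMangoldt_eq_typeI_add_tail' f η x, mul_add]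
  nlinarith [hup', hlo, hC]

/-- A linear lower bound on `∑_{n ≤ x} ∏ Λ(fᵢ(n))` forces infinitely many `n` at which every `fᵢ(n)` is a
prime power. [folklore] -/
theorem infinite_primePow_tuples_of_linear_lower {k : ℕ} (f : Fin k → ℤ[X]) {c : ℝ} (hc : 0 < c)
    (h : ∀ᶠ x : ℕ in atTop, c * (x : ℝ) ≤ ∑ n ∈ Finset.Icc 1 x, ∏ i, vonMangoldt (((f i).eval (n : ℤ)).toNat)) :
    {n : ℕ | ∀ i, IsPrimePow (((f i).eval (n : ℤ)).toNat)}.Infinite := by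
  set a : ℕ → ℝ := fun n => ∏ i, vonMangoldt (((f i).eval (n : ℤ)).toNat) with ha
  have ha0 : ∀ n, 0 ≤ a n := fun n => Finset.prod_nonneg fun i _ => vonMangoldt_nonneg
  have hpos : ∀ n, 0 < a n → ∀ i, IsPrimePow (((f i).eval (n : ℤ)).toNat) := by
    intro n hn i
    have hne : vonMangoldt (((f i).eval (n : ℤ)).toNat) ≠ 0 := by
      intro h0
      exact hn.ne' (Finset.prod_eq_zero (Finset.mem_univ i) h0)
    exact vonMangoldt_pos_iff.mp (lt_of_le_of_ne vonMangoldt_nonneg (Ne.symm hne))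
  by_contra hfin
  rw [Set.not_infinite] at hfin
  obtain ⟨N, hN⟩ := hfin.bddAbove
  -- beyond `N` every term vanishes, so the partial sums are bounded by `B`
  set B : ℝ := ∑ n ∈ Finset.Icc 1 N, a n with hB
  have hzero : ∀ n, N < n → a n = 0 := by
    intro n hn
    by_contra hne
    have hp := hpos n (lt_of_le_of_ne (ha0 n) (Ne.symm hne))
    exact absurd (hN hp) (not_le.mpr hn)
  have hbound : ∀ x : ℕ, ∑ n ∈ Finset.Icc 1 x, a n ≤ B := by
    intro x
    have hsub : ∑ n ∈ (Finset.Icc 1 x).filter (fun n => n ≤ N), a n = ∑ n ∈ Finset.Icc 1 x, a n := by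
      refine Finset.sum_subset (Finset.filter_subset _ _) fun n hn hnot => ?_
      simp only [Finset.mem_filter, not_and, not_le] at hnot
      exact hzero n (hnot hn)
    rw [← hsub]
    refine Finset.sum_le_sum_of_subset_of_nonneg ?_ fun n _ _ => ha0 n
    intro n hn
    simp only [Finset.mem_filter, Finset.mem_Icc] at hn ⊢
    exact ⟨hn.1.1, hn.2⟩
  -- contradiction with `c x → ∞`
  have hev := h.and (eventually_gt_atTop ⌈B / c⌉₊)
  obtain ⟨x, hx, hxB⟩ := hev.exists
  have hx' : B / c < x := lt_of_le_of_lt (Nat.le_ceil _) (by exact_mod_cast hxB)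
  rw [div_lt_iff₀ hc] at hx'
  have := (hx.trans (hbound x))
  nlinarith


end Summit.Parity.BatemanHorn.Cruxes.PolyMobiusTail.Disproof
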